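import Literature.Computability.AlgebraicComplexity.Kron444HullCheck
import Literature.Computability.AlgebraicComplexity.PolyhedralHullCertificates
import Mathlib.LinearAlgebra.Matrix.NonsingularInverse
import Mathlib.LinearAlgebra.Matrix.Nondegenerate
import Mathlib.LinearAlgebra.LinearIndependent.Lemmas
import Mathlib.Data.ZMod.Basic
import Mathlib.Tactic.NormNum.Prime
import HarnessLib

/-!
# `Kron(4,4,4) ⊆ conv(328 vertices)`: soundness of the certificate checker

Topic `Computability/AlgebraicComplexity`; serves the named fact
`vandenBergEtAl2025_unitTensor_four_polytope_maximal` (layer `KroneckerConeGenerators`). This file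
proves that the finite checks of `Kron444HullCheck.lean` (decided by the kernel in
`Kron444HullChecks*.lean`) imply the polytope-verification statement
[Ziegler1995, Lecture 1]: every `x ∈ ℚ¹²` with the three blocks summing to `1` and satisfying the 270
Vergne–Walter inequalities [VergneWalter2014, §6.2] is a convex combination of the 328 listed
vertices (`mem_convexHull_of_checks`). The argument is the face recursion of
`PolyhedralHullCertificates.lean`: node `m` of the certificate describes the face
`Q m = {E = 0, g_b = 0 (b ∈ B m), gₖ ≥ 0 (k ∈ R m)}`; by reverse induction over the nodes every
point of `Q m` lies in the convex hull of the vertices (line shooting from the apex vertex,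
exit through a child face, transfer of the tight equalities by a dimension count, Farkas
certificates for the child's remaining inequalities); linear independence of the equality
functionals `B m ∪ E` follows top-down from `B m = B parent ++ [cut row]` (the cut row does not
vanish at the parent's apex) and affine independence of `basis m` bottom-up from
`basis m = basis child ++ [apex]`; boundedness of each face comes from the positive combination
`∑ yₖ Aₖ + ∑ z_b A_b + ∑ z'ₜ 1ₜ = 0` and the invertibility (modulo a prime, verified) of the
direction matrix of the face. [folklore]

## References

* [Ziegler1995] G. M. Ziegler, *Lectures on Polytopes*, Lecture 1 (Thm. 1.1), §2.1, §8.1.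
* [Schrijver1986] A. Schrijver, *Theory of Linear and Integer Programming*, §7.3 (Cor. 7.1e), §7.8.
* [VergneWalter2014] M. Vergne, M. Walter, arXiv:1410.8144, §6.2 and Tables (`C(4,4,4)`).
-/

set_option Elab.async false

open scoped BigOperators Matrix

namespace Literature.Computability.AlgebraicComplexity

namespace Kron444Hull

/-! ## §1 Semantics of rows, vertices and points -/

/-- The `i`-th entry of an integer list, cast to `ℚ`. [folklore] -/
def qent (l : List ℤ) (i : ℕ) : ℚ := ((l.getD i 0 : ℤ) : ℚ)

/-- The affine functional of facet `k` as a vector of `ℚ¹³`: `(Aₖ, zₖ)`. [folklore] -/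
def hz (k : ℕ) : Fin 13 → ℚ := fun i => qent (rowAz k) i

/-- The homogenised vertex `r` as a vector of `ℚ¹³`: `(denᵣ vᵣ, denᵣ)`. [folklore] -/
def hv (r : ℕ) : Fin 13 → ℚ := fun i => qent (rowVert r) i

/-- The normalisation functional `(1ₜ, -1)` as a vector of `ℚ¹³`. [folklore] -/
def hE (t : ℕ) : Fin 13 → ℚ := fun i => qent (rowOneAff t) i

/-- The homogenisation `(x, 1) ∈ ℚ¹³` of a point `x ∈ ℚ¹²`. [folklore] -/
def hx (x : Fin 12 → ℚ) : Fin 13 → ℚ := fun i => if h : (i : ℕ) < 12 then x ⟨i, h⟩ else 1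

/-- The value `gₖ(x) = Aₖ · x + zₖ` of the facet functional `k` at `x`. [folklore] -/
def gq (k : ℕ) (x : Fin 12 → ℚ) : ℚ := hz k ⬝ᵥ hx x

/-- The vertex `r`: `vᵣ = Wᵣ / denᵣ`. [folklore] -/
def vq (r : ℕ) : Fin 12 → ℚ := fun i => qent (rowVert r) i / qent (rowVert r) 12

/-- The linear part `Aₖ ∈ ℚ¹²` of facet `k`. [folklore] -/
def aq (k : ℕ) : Fin 12 → ℚ := fun i => qent (rowAz k) i

/-- The set of the 328 vertices. [folklore] -/
def Vset : Set (Fin 12 → ℚ) := {p | ∃ r, r < nV ∧ p = vq r}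

/-- A point satisfies the constraints of the node record `rc`: normalised blocks, the equality rows
`B` vanish, the inequality rows `R` are non-negative. [folklore] -/
def InQ (rc : Rec) (x : Fin 12 → ℚ) : Prop :=
  (∀ t, t < 3 → hE t ⬝ᵥ hx x = 0) ∧ (∀ b ∈ rc.B, gq b x = 0) ∧ (∀ k ∈ rc.R, 0 ≤ gq k x)

/-! ### Lengths and entries -/

/-- Auxiliary lemma `length_rowAz`. [folklore] -/
theorem length_rowAz (k : ℕ) : (rowAz k).length = 13 := by
  unfold rowAz; split_ifs <;> simp

/-- Auxiliary lemma `length_rowVert`. [folklore] -/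
theorem length_rowVert (r : ℕ) : (rowVert r).length = 13 := by
  simp [rowVert]

/-- Auxiliary lemma `length_rowOne`. [folklore] -/
theorem length_rowOne (t : ℕ) : (rowOne t).length = 12 := by simp [rowOne]

/-- Auxiliary lemma `length_rowOneAff`. [folklore] -/
theorem length_rowOneAff (t : ℕ) : (rowOneAff t).length = 13 := by simp [rowOneAff, rowOne]

/-- Auxiliary lemma `length_rowA`. [folklore] -/
theorem length_rowA (k : ℕ) : (rowA k).length = 12 := by simp [rowA, length_rowAz]

/-- Auxiliary lemma `getD_rowA`. [folklore] -/
theorem getD_rowA (k i : ℕ) (hi : i < 12) : (rowA k).getD i 0 = (rowAz k).getD i 0 := by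
  rw [rowA, List.getD_eq_getElem?_getD, List.getD_eq_getElem?_getD, List.getElem?_take, if_pos hi]

/-- Auxiliary lemma `getD_rowOneAff_lt`. [folklore] -/
theorem getD_rowOneAff_lt (t i : ℕ) (hi : i < 12) : (rowOneAff t).getD i 0 = (rowOne t).getD i 0 := by
  rw [rowOneAff, List.getD_eq_getElem?_getD, List.getElem?_append_left (by rw [length_rowOne]; exact hi),
    ← List.getD_eq_getElem?_getD]

/-- Auxiliary lemma `getD_rowOneAff_12`. [folklore] -/
theorem getD_rowOneAff_12 (t : ℕ) : (rowOneAff t).getD 12 0 = -1 := by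
  rw [rowOneAff, List.getD_eq_getElem?_getD, List.getElem?_append_right (by rw [length_rowOne]),
    length_rowOne]
  simp

/-- Auxiliary lemma `getD_rowOne`. [folklore] -/
theorem getD_rowOne (t i : ℕ) (hi : i < 12) : (rowOne t).getD i 0 = if i / 4 = t then 1 else 0 := by
  rw [rowOne, List.getD_eq_getElem?_getD, List.getElem?_map, List.getElem?_range hi]
  simp

/-! ### Dot products of lists -/

/-- `dotL` on cons. [folklore] -/
theorem dotL_cons (a b : ℤ) (u v : List ℤ) : dotL (a :: u) (b :: v) = a * b + dotL u v := by
  simp [dotL]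

/-- Auxiliary lemma `dotL_nil_left`. [folklore] -/
theorem dotL_nil_left (v : List ℤ) : dotL [] v = 0 := by simp [dotL]

/-- The list dot product is the dot product of the entry vectors (lists of length `n`). [folklore] -/
theorem dotL_eq_sum (n : ℕ) : ∀ (u v : List ℤ), u.length = n → v.length = n →
    (dotL u v : ℚ) = ∑ i : Fin n, qent u i * qent v i := by
  induction n with
  | zero => intro u v hu hv; rw [List.length_eq_zero_iff] at hu; subst hu; simp [dotL]
  | succ n ih =>
    intro u v hu hv
    match u, v, hu, hv with
    | a :: u, b :: v, hu, hv =>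
      simp only [List.length_cons, Nat.add_right_cancel_iff] at hu hv
      rw [dotL_cons, Int.cast_add, Int.cast_mul, ih u v hu hv, Fin.sum_univ_succ]
      simp [qent]

/-- `(Aₖ, zₖ) · (den vᵣ, den) = dotL (rowAz k) (rowVert r)`. [folklore] -/
theorem hz_dot_hv (k r : ℕ) : hz k ⬝ᵥ hv r = (dotL (rowAz k) (rowVert r) : ℚ) := by
  rw [dotL_eq_sum 13 _ _ (length_rowAz k) (length_rowVert r)]
  rfl

/-- `(1ₜ, -1) · (den vᵣ, den) = dotL (rowOneAff t) (rowVert r)`. [folklore] -/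
theorem hE_dot_hv (t r : ℕ) : hE t ⬝ᵥ hv r = (dotL (rowOneAff t) (rowVert r) : ℚ) := by
  rw [dotL_eq_sum 13 _ _ (length_rowOneAff t) (length_rowVert r)]
  rfl

/-- The homogenisation of a vertex is its homogenised vector divided by the denominator. [folklore] -/
theorem hx_vq (r : ℕ) (hd : qent (rowVert r) 12 ≠ 0) : hx (vq r) = (qent (rowVert r) 12)⁻¹ • hv r := by
  funext i
  simp only [hx, vq, hv, Pi.smul_apply, smul_eq_mul]
  split_ifs with h
  · rw [div_eq_inv_mul]
  · have : (i : ℕ) = 12 := by omega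
    rw [this, inv_mul_cancel₀ hd]

/-- `gₖ(vᵣ) = (dotL (rowAz k) (rowVert r)) / denᵣ`. [folklore] -/
theorem gq_vq (k r : ℕ) (hd : qent (rowVert r) 12 ≠ 0) :
    gq k (vq r) = (qent (rowVert r) 12)⁻¹ * (dotL (rowAz k) (rowVert r) : ℚ) := by
  rw [gq, hx_vq r hd, dotProduct_smul, smul_eq_mul, hz_dot_hv]

/-- Normalisation of a vertex from the integer identity `dotL (1ₜ,-1) (den v, den) = 0`. [folklore] -/
theorem hE_dot_hx_vq (t r : ℕ) (hd : qent (rowVert r) 12 ≠ 0) (h0 : dotL (rowOneAff t) (rowVert r) = 0) :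
    hE t ⬝ᵥ hx (vq r) = 0 := by
  rw [hx_vq r hd, dotProduct_smul, smul_eq_mul, hE_dot_hv, h0, Int.cast_zero, mul_zero]

/-- The linear part (first `12` coordinates) of a vector of `ℚ¹³`. [folklore] -/
def linPart (w : Fin 13 → ℚ) : Fin 12 → ℚ := fun i => w (Fin.castSucc i)

/-- Pairing with a homogenised point: `w · (x, 1) = lin(w) · x + w₁₂`. [folklore] -/
theorem dot_hx (w : Fin 13 → ℚ) (x : Fin 12 → ℚ) : w ⬝ᵥ hx x = linPart w ⬝ᵥ x + w (Fin.last 12) := by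
  have h1 : w ⬝ᵥ hx x = ∑ i : Fin 13, w i * hx x i := rfl
  have h2 : linPart w ⬝ᵥ x = ∑ i : Fin 12, w (Fin.castSucc i) * x i := rfl
  rw [h1, h2, Fin.sum_univ_castSucc (f := fun i : Fin 13 => w i * hx x i)]
  have hlast : hx x (Fin.last 12) = 1 := by
    have : ¬ ((Fin.last 12 : Fin 13) : ℕ) < 12 := by simp
    simp only [hx, this, dif_neg, not_false_eq_true]
  have hcast : ∀ i : Fin 12, hx x (Fin.castSucc i) = x i := by
    intro i
    simp only [hx, Fin.val_castSucc, Fin.is_lt, dif_pos, Fin.eta]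
  simp only [hlast, hcast, mul_one]

/-- Pairing with homogenised points is affine along segments:
`w·(v + t(x-v), 1) = w·(v,1) + t (w·(x,1) - w·(v,1))`. [folklore] -/
theorem dot_hx_line (w : Fin 13 → ℚ) (v x : Fin 12 → ℚ) (t : ℚ) :
    w ⬝ᵥ hx (v + t • (x - v)) = w ⬝ᵥ hx v + t * (w ⬝ᵥ hx x - w ⬝ᵥ hx v) := by
  simp only [dot_hx, dotProduct_add, dotProduct_smul, dotProduct_sub, smul_eq_mul]; ring

/-- Differences: `w·(x,1) - w·(v,1) = lin(w) · (x - v)`. [folklore] -/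
theorem dot_hx_sub (w : Fin 13 → ℚ) (x v : Fin 12 → ℚ) : w ⬝ᵥ hx x - w ⬝ᵥ hx v = linPart w ⬝ᵥ (x - v) := by
  rw [dot_hx, dot_hx, dotProduct_sub]; ring

/-- The linear part of the facet functional is `Aₖ`. [folklore] -/
theorem linPart_hz (k : ℕ) : linPart (hz k) = aq k := rfl

/-- `gₖ(x) = Aₖ · x + zₖ`. [folklore] -/
theorem gq_eq (k : ℕ) (x : Fin 12 → ℚ) : gq k x = aq k ⬝ᵥ x + qent (rowAz k) 12 := by
  rw [gq, dot_hx]; rfl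

/-- `gₖ` along a segment. [folklore] -/
theorem gq_line (k : ℕ) (v x : Fin 12 → ℚ) (t : ℚ) :
    gq k (v + t • (x - v)) = gq k v + t * (gq k x - gq k v) := dot_hx_line _ _ _ _

/-- `gₖ(x) - gₖ(v) = Aₖ · (x - v)`. [folklore] -/
theorem gq_sub (k : ℕ) (x v : Fin 12 → ℚ) : gq k x - gq k v = aq k ⬝ᵥ (x - v) := dot_hx_sub _ _ _

/-- The normalisation functional along a segment. [folklore] -/
theorem hE_line (s : ℕ) (v x : Fin 12 → ℚ) (t : ℚ) :
    hE s ⬝ᵥ hx (v + t • (x - v)) = hE s ⬝ᵥ hx v + t * (hE s ⬝ᵥ hx x - hE s ⬝ᵥ hx v) :=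
  dot_hx_line _ _ _ _

/-- The linear part of the normalisation functional is the block indicator `1ₛ`. [folklore] -/
theorem linPart_hE (s : ℕ) (i : Fin 12) : linPart (hE s) i = if (i : ℕ) / 4 = s then 1 else 0 := by
  simp only [linPart, hE, qent, Fin.val_castSucc]
  rw [getD_rowOneAff_lt s i i.2, getD_rowOne s i i.2]
  split_ifs <;> simp

/-- The constant of the normalisation functional is `-1`. [folklore] -/
theorem hE_last (s : ℕ) : hE s (Fin.last 12) = -1 := by
  simp only [hE, qent, Fin.val_last]
  rw [getD_rowOneAff_12]; simp

/-- The normalisation functional at a point: `(1ₛ,-1)·(x,1) = ∑_{i ∈ block s} xᵢ - 1`. [folklore] -/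
theorem hE_dot_hx (s : ℕ) (x : Fin 12 → ℚ) :
    hE s ⬝ᵥ hx x = (∑ i : Fin 12, if (i : ℕ) / 4 = s then x i else 0) - 1 := by
  rw [dot_hx, hE_last, dotProduct]
  simp only [linPart_hE, ite_mul, one_mul, zero_mul]
  ring

/-! ## §2 Semantics of the list computations of the checker -/

/-- The vector of `ℚⁿ` of the first `n` entries of an integer list. [folklore] -/
def vecOf (n : ℕ) (l : List ℤ) : Fin n → ℚ := fun i => qent l i

/-- Auxiliary lemma `vecOf_rowA`. [folklore] -/
theorem vecOf_rowA (k : ℕ) : vecOf 12 (rowA k) = aq k := by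
  funext i; simp only [vecOf, aq, qent, getD_rowA k i i.2]

/-- Auxiliary lemma `vecOf_rowAz_13`. [folklore] -/
theorem vecOf_rowAz_13 (k : ℕ) : vecOf 13 (rowAz k) = hz k := rfl

/-- Auxiliary lemma `vecOf_rowVert`. [folklore] -/
theorem vecOf_rowVert (r : ℕ) : vecOf 13 (rowVert r) = hv r := rfl

/-- Auxiliary lemma `vecOf_rowOne`. [folklore] -/
theorem vecOf_rowOne (t : ℕ) : vecOf 12 (rowOne t) = linPart (hE t) := by
  funext i; rw [linPart_hE]; simp only [vecOf, qent, getD_rowOne t i i.2]; split_ifs <;> simp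

/-- Auxiliary lemma `vecOf_rowOneAff`. [folklore] -/
theorem vecOf_rowOneAff (t : ℕ) : vecOf 13 (rowOneAff t) = hE t := rfl

/-- Auxiliary lemma `vecOf_take12_rowAz`. [folklore] -/
theorem vecOf_take12_rowAz (k : ℕ) : vecOf 12 ((rowAz k).take 12) = aq k := vecOf_rowA k

/-- Entries of `zipWith` of lists of length `n`. [folklore] -/
theorem getD_zipWith {f : ℤ → ℤ → ℤ} (hf : f 0 0 = 0) : ∀ (u v : List ℤ) (i : ℕ),
    u.length = v.length → (List.zipWith f u v).getD i 0 = f (u.getD i 0) (v.getD i 0)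
  | [], [], i, _ => by simp [hf]
  | a :: u, b :: v, 0, _ => by simp
  | a :: u, b :: v, i + 1, h => by
    simp only [List.zipWith_cons_cons, List.getD_cons_succ]
    exact getD_zipWith hf u v i (by simpa using h)
  | [], _ :: _, _, h => by simp at h
  | _ :: _, [], _, h => by simp at h

/-- Auxiliary lemma `length_zeroVec`. [folklore] -/
theorem length_zeroVec (n : ℕ) : (zeroVec n).length = n := by simp [zeroVec]

/-- Auxiliary lemma `getD_zeroVec`. [folklore] -/
theorem getD_zeroVec (n i : ℕ) : (zeroVec n).getD i 0 = 0 := by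
  rw [zeroVec, List.getD_eq_getElem?_getD, List.getElem?_map]
  by_cases h : i < n
  · rw [List.getElem?_range h]; rfl
  · rw [List.getElem?_eq_none (by simp; omega)]; rfl

/-- Auxiliary lemma `length_axpy`. [folklore] -/
theorem length_axpy (c : ℤ) (row acc : List ℤ) (h : row.length = acc.length) :
    (axpy c row acc).length = acc.length := by
  simp [axpy, List.length_zipWith, h]

/-- Auxiliary lemma `getD_axpy`. [folklore] -/
theorem getD_axpy (c : ℤ) (row acc : List ℤ) (h : row.length = acc.length) (i : ℕ) :
    (axpy c row acc).getD i 0 = c * row.getD i 0 + acc.getD i 0 := by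
  rw [axpy, getD_zipWith (f := fun a b => c * a + b) (by simp) row acc i h]

/-- **Semantics of `lincomb`**: the entries of `∑ⱼ cⱼ • rowⱼ` (rows of length `n`). [folklore] -/
theorem lincomb_spec (n : ℕ) (coef : List ℤ) (rows : List (List ℤ))
    (hrows : ∀ row ∈ rows, row.length = n) :
    (lincomb n coef rows).length = n ∧
      ∀ i, ((lincomb n coef rows).getD i 0 : ℚ) =
        ((List.zip coef rows).map fun cr => (cr.1 : ℚ) * (cr.2.getD i 0 : ℚ)).sum := by
  unfold lincomb
  generalize hz : List.zip coef rows = zs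
  have hzs : ∀ cr ∈ zs, cr.2.length = n := by
    intro cr hcr; rw [← hz] at hcr
    exact hrows _ (List.of_mem_zip hcr).2
  clear hz hrows
  induction zs with
  | nil => exact ⟨length_zeroVec n, fun i => by
      rw [List.foldr_nil, getD_zeroVec]; simp⟩
  | cons cr zs ih =>
    obtain ⟨ihl, ihg⟩ := ih (fun x hx => hzs x (List.mem_cons_of_mem _ hx))
    have hl : cr.2.length = (List.foldr (fun cr acc => axpy cr.1 cr.2 acc) (zeroVec n) zs).length := by
      rw [ihl]; exact hzs cr List.mem_cons_self
    refine ⟨by rw [List.foldr_cons, length_axpy _ _ _ hl, ihl], fun i => ?_⟩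
    rw [List.foldr_cons, getD_axpy _ _ _ hl, List.map_cons, List.sum_cons, Int.cast_add, Int.cast_mul, ihg i]

/-- Evaluating a list sum of vectors at a coordinate. [folklore] -/
theorem list_sum_apply {n : ℕ} (L : List (Fin n → ℚ)) (i : Fin n) : L.sum i = (L.map fun f => f i).sum := by
  induction L with
  | nil => rfl
  | cons a L ih => rw [List.sum_cons, Pi.add_apply, ih, List.map_cons, List.sum_cons]

/-- `lincomb` as a vector: `∑ⱼ cⱼ • vecOf n rowⱼ`. [folklore] -/
theorem vecOf_lincomb (n : ℕ) (coef : List ℤ) (rows : List (List ℤ))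
    (hrows : ∀ row ∈ rows, row.length = n) :
    vecOf n (lincomb n coef rows) = ((List.zip coef rows).map fun cr => (cr.1 : ℚ) • vecOf n cr.2).sum := by
  funext i
  rw [list_sum_apply, List.map_map]
  unfold vecOf qent
  rw [(lincomb_spec n coef rows hrows).2 i]
  refine congrArg List.sum (List.map_congr_left fun cr _ => ?_)
  simp

/-- Auxiliary lemma `length_lincomb`. [folklore] -/
theorem length_lincomb (n : ℕ) (coef : List ℤ) (rows : List (List ℤ))
    (hrows : ∀ row ∈ rows, row.length = n) : (lincomb n coef rows).length = n :=
  (lincomb_spec n coef rows hrows).1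

/-- Auxiliary lemma `vecOf_vadd`. [folklore] -/
theorem vecOf_vadd (n : ℕ) (u v : List ℤ) (hu : u.length = n) (hv : v.length = n) :
    vecOf n (vadd u v) = vecOf n u + vecOf n v := by
  funext i
  simp only [vecOf, qent, vadd, Pi.add_apply]
  rw [getD_zipWith (f := (· + ·)) (by simp) u v i (by rw [hu, hv]), Int.cast_add]

/-- Auxiliary lemma `length_vadd`. [folklore] -/
theorem length_vadd (u v : List ℤ) (h : u.length = v.length) : (vadd u v).length = u.length := by
  simp [vadd, List.length_zipWith, h]

/-- A list whose entries are all `== 0` is the zero vector. [folklore] -/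
theorem vecOf_eq_zero_of_all (n : ℕ) (l : List ℤ) (hl : l.length = n) (h : l.all (· == 0) = true) :
    vecOf n l = 0 := by
  funext i
  rw [List.all_eq_true] at h
  have hi : i.1 < l.length := by rw [hl]; exact i.2
  have hmem : l[i.1] ∈ l := List.getElem_mem hi
  have := h _ hmem
  rw [beq_iff_eq] at this
  simp only [vecOf, qent, Pi.zero_apply, List.getD_eq_getElem?_getD, List.getElem?_eq_getElem hi,
    Option.getD_some, this, Int.cast_zero]

/-- Dot product with a list sum of vectors. [folklore] -/
theorem list_sum_dotProduct {n : ℕ} (L : List (Fin n → ℚ)) (u : Fin n → ℚ) :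
    L.sum ⬝ᵥ u = (L.map (· ⬝ᵥ u)).sum := by
  induction L with
  | nil => simp
  | cons a L ih => rw [List.sum_cons, add_dotProduct, ih, List.map_cons, List.sum_cons]

/-- A sum `∑ (yᵢ dᵢ)` of products with `yᵢ ≥ 1`, `dᵢ ≥ 0` vanishes only if every `dᵢ = 0`
(list form). [cite: Schrijver1986, §7.8] -/
theorem forall_zero_of_list_sum (l : List (ℚ × ℚ)) (hy : ∀ p ∈ l, 1 ≤ p.1) (hd : ∀ p ∈ l, 0 ≤ p.2)
    (h : (l.map fun p => p.1 * p.2).sum = 0) : ∀ p ∈ l, p.2 = 0 := by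
  induction l with
  | nil => simp
  | cons q l ih =>
    have hq1 : 1 ≤ q.1 := hy q List.mem_cons_self
    have hq2 : 0 ≤ q.2 := hd q List.mem_cons_self
    have hrest : 0 ≤ (l.map fun p => p.1 * p.2).sum :=
      List.sum_nonneg (by
        intro x hx
        rw [List.mem_map] at hx
        obtain ⟨p, hp, rfl⟩ := hx
        exact mul_nonneg (le_trans zero_le_one (hy p (List.mem_cons_of_mem _ hp)))
          (hd p (List.mem_cons_of_mem _ hp)))
    rw [List.map_cons, List.sum_cons] at h
    have hprod : q.1 * q.2 = 0 := by nlinarith [mul_nonneg (le_trans zero_le_one hq1) hq2]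
    have hq : q.2 = 0 := by
      rcases mul_eq_zero.1 hprod with h1 | h1
      · linarith
      · exact h1
    intro p hp
    rcases List.mem_cons.1 hp with rfl | hp
    · exact hq
    · exact ih (fun p hp' => hy p (List.mem_cons_of_mem _ hp'))
        (fun p hp' => hd p (List.mem_cons_of_mem _ hp')) (by rw [hprod, zero_add] at h; exact h) p hp

/-! ## §3 The boundedness identity, the Farkas certificates and the rank certificate -/

section BoundCert

/-- `zip` with a mapped right list. [folklore] -/
theorem zip_map_right' {α β γ : Type*} (l : List α) (m : List β) (f : β → γ) :
    List.zip l (m.map f) = (List.zip l m).map (fun p => (p.1, f p.2)) := by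
  induction l generalizing m with
  | nil => simp
  | cons a l ih => cases m <;> simp [ih]

/-- `zip` with a mapped left list. [folklore] -/
theorem zip_map_left' {α β γ : Type*} (l : List α) (m : List β) (f : α → γ) :
    List.zip (l.map f) m = (List.zip l m).map (fun p => (f p.1, p.2)) := by
  induction l generalizing m with
  | nil => simp
  | cons a l ih => cases m <;> simp [ih]

/-- **Semantics of the boundedness check**: `yₖ ≥ 1` and the vector identity
`∑ yₖ Aₖ + ∑ z_b A_b + ∑ₜ z'ₜ 1ₜ = 0` in `ℚ¹²`. [folklore] -/
theorem bound_identity (rc : Rec) (h : checkBound rc (rc.R.map rowA) (rc.B.map rowA) = true) :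
    (∀ y ∈ rc.y, 1 ≤ y) ∧ rc.y.length = rc.R.length ∧
    ((List.zip rc.y rc.R).map fun p => ((p.1 : ℤ) : ℚ) • aq p.2).sum +
      ((List.zip rc.z rc.B).map fun p => (p.1 : ℚ) • aq p.2).sum +
      ((List.zip rc.zp [0, 1, 2]).map fun p => (p.1 : ℚ) • linPart (hE p.2)).sum = 0 := by
  simp only [checkBound, Bool.and_eq_true, beq_iff_eq, List.all_eq_true, decide_eq_true_eq] at h
  obtain ⟨⟨⟨⟨hyl, hzl⟩, hzpl⟩, hy1⟩, hall⟩ := h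
  refine ⟨hy1, hyl, ?_⟩
  have hR : ∀ row ∈ rc.R.map rowA, row.length = 12 := by
    intro row hrow; rw [List.mem_map] at hrow; obtain ⟨k, -, rfl⟩ := hrow; exact length_rowA k
  have hB : ∀ row ∈ rc.B.map rowA, row.length = 12 := by
    intro row hrow; rw [List.mem_map] at hrow; obtain ⟨k, -, rfl⟩ := hrow; exact length_rowA k
  have hO : ∀ row ∈ [rowOne 0, rowOne 1, rowOne 2], row.length = 12 := by
    intro row hrow; simp only [List.mem_cons, List.mem_nil_iff, or_false] at hrow
    rcases hrow with rfl | rfl | rfl <;> exact length_rowOne _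
  have l1 := length_lincomb 12 (rc.y.map fun y : ℕ => (y : ℤ)) _ hR
  have l2 := length_lincomb 12 rc.z _ hB
  have l3 := length_lincomb 12 rc.zp _ hO
  set L1 := lincomb 12 (rc.y.map fun y : ℕ => (y : ℤ)) (rc.R.map rowA) with hL1
  set L2 := lincomb 12 rc.z (rc.B.map rowA) with hL2
  set L3 := lincomb 12 rc.zp [rowOne 0, rowOne 1, rowOne 2] with hL3
  have l12 : (vadd L1 L2).length = 12 := by rw [length_vadd _ _ (by rw [l1, l2]), l1]
  have l123 : (vadd (vadd L1 L2) L3).length = 12 := by rw [length_vadd _ _ (by rw [l12, l3]), l12]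
  have hv : vecOf 12 (vadd (vadd L1 L2) L3) = 0 := by
    funext i
    have hi : i.1 < (vadd (vadd L1 L2) L3).length := by rw [l123]; exact i.2
    have := hall _ (List.getElem_mem hi)
    simp only [vecOf, qent, Pi.zero_apply, List.getD_eq_getElem?_getD, List.getElem?_eq_getElem hi,
      Option.getD_some, this, Int.cast_zero]
  rw [vecOf_vadd 12 _ _ l12 l3, vecOf_vadd 12 _ _ l1 l2, hL1, hL2, hL3, vecOf_lincomb 12 _ _ hR,
    vecOf_lincomb 12 _ _ hB, vecOf_lincomb 12 _ _ hO] at hv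
  have e1 : ((List.zip (rc.y.map fun y : ℕ => (y : ℤ)) (rc.R.map rowA)).map
      fun cr => (cr.1 : ℚ) • vecOf 12 cr.2) = (List.zip rc.y rc.R).map fun p => ((p.1 : ℤ) : ℚ) • aq p.2 := by
    rw [zip_map_left', zip_map_right', List.map_map, List.map_map]
    refine List.map_congr_left fun p _ => ?_
    simp [vecOf_rowA]
  have e2 : ((List.zip rc.z (rc.B.map rowA)).map fun cr => (cr.1 : ℚ) • vecOf 12 cr.2) =
      (List.zip rc.z rc.B).map fun p => (p.1 : ℚ) • aq p.2 := by
    rw [zip_map_right', List.map_map]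
    refine List.map_congr_left fun p _ => ?_
    simp [vecOf_rowA]
  have e3 : ((List.zip rc.zp [rowOne 0, rowOne 1, rowOne 2]).map fun cr => (cr.1 : ℚ) • vecOf 12 cr.2) =
      (List.zip rc.zp [0, 1, 2]).map fun p => (p.1 : ℚ) • linPart (hE p.2) := by
    rw [show ([rowOne 0, rowOne 1, rowOne 2] : List (List ℤ)) = ([0, 1, 2] : List ℕ).map rowOne from rfl,
      zip_map_right', List.map_map]
    refine List.map_congr_left fun p _ => ?_
    simp [vecOf_rowOne]
  rw [e1, e2, e3] at hv
  exact hv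

/-- **Semantics of a Farkas certificate**: paired with a homogenised point `(x, 1)`,
`D gₖ'(x) = ∑ yⱼ g_{Rⱼ}(x) + ∑ wⱼ g_{BBⱼ}(x) + ∑ₜ w'ₜ ((1ₜ,-1)·(x,1)) + s`, with `D > 0`,
`yⱼ ≥ 0` (naturals), `s ≥ 0`. [cite: Schrijver1986, Cor. 7.1e] -/
theorem cert_identity (rc : Rec) (BB : List ℕ) (ce : Cert)
    (h : checkCert rc (rc.R.map rowAz) (BB.map rowAz) ce = true) (x : Fin 12 → ℚ) :
    0 < ce.D ∧
    (ce.D : ℚ) * gq ce.row x =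
      ((List.zip ce.y rc.R).map fun p => ((p.1 : ℕ) : ℚ) * gq p.2 x).sum +
      ((List.zip ce.w BB).map fun p => (p.1 : ℚ) * gq p.2 x).sum +
      ((List.zip ce.wp [0, 1, 2]).map fun p => (p.1 : ℚ) * (hE p.2 ⬝ᵥ hx x)).sum + (ce.s : ℚ) := by
  simp only [checkCert, Bool.and_eq_true, beq_iff_eq, List.all_eq_true, decide_eq_true_eq] at h
  obtain ⟨⟨⟨⟨hD, hyl⟩, hwl⟩, hwpl⟩, ⟨hlenl, hlenr⟩, hall⟩ := h
  refine ⟨hD, ?_⟩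
  have hR : ∀ row ∈ rc.R.map rowAz, row.length = 13 := by
    intro row hrow; rw [List.mem_map] at hrow; obtain ⟨k, -, rfl⟩ := hrow; exact length_rowAz k
  have hB : ∀ row ∈ BB.map rowAz, row.length = 13 := by
    intro row hrow; rw [List.mem_map] at hrow; obtain ⟨k, -, rfl⟩ := hrow; exact length_rowAz k
  have hO : ∀ row ∈ [rowOneAff 0, rowOneAff 1, rowOneAff 2], row.length = 13 := by
    intro row hrow; simp only [List.mem_cons, List.mem_nil_iff, or_false] at hrow
    rcases hrow with rfl | rfl | rfl <;> exact length_rowOneAff _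
  -- the two sides as vectors of `ℚ¹³`
  set lhs : List ℤ := (rowAz ce.row).map fun a => (ce.D : ℤ) * a with hlhs
  set rhs : List ℤ := vadd (vadd (vadd (lincomb 13 (ce.y.map fun y : ℕ => (y : ℤ)) (rc.R.map rowAz))
      (lincomb 13 ce.w (BB.map rowAz))) (lincomb 13 ce.wp [rowOneAff 0, rowOneAff 1, rowOneAff 2]))
      ((List.range 13).map fun i => if i = 12 then (ce.s : ℤ) else 0) with hrhs
  have heq : vecOf 13 lhs = vecOf 13 rhs := by
    funext i
    have hi1 : i.1 < lhs.length := by rw [hlenl]; exact i.2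
    have hi2 : i.1 < rhs.length := by rw [hlenr]; exact i.2
    have hzw := hall _ (List.getElem_mem (l := List.zipWith (fun a b => a == b) lhs rhs)
      (n := i.1) (by rw [List.length_zipWith, hlenl, hlenr]; exact i.2))
    rw [List.getElem_zipWith, id, beq_iff_eq] at hzw
    simp only [vecOf, qent, List.getD_eq_getElem?_getD, List.getElem?_eq_getElem hi1,
      List.getElem?_eq_getElem hi2, Option.getD_some, hzw]
  -- pair with `(x, 1)`
  have hpair : vecOf 13 lhs ⬝ᵥ hx x = vecOf 13 rhs ⬝ᵥ hx x := by rw [heq]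
  -- left side
  have hl : vecOf 13 lhs ⬝ᵥ hx x = (ce.D : ℚ) * gq ce.row x := by
    rw [gq, dotProduct, dotProduct, Finset.mul_sum]
    refine Finset.sum_congr rfl fun i _ => ?_
    have : (lhs.getD i 0 : ℤ) = (ce.D : ℤ) * (rowAz ce.row).getD i 0 := by
      have hi : i.1 < (rowAz ce.row).length := by rw [length_rowAz]; exact i.2
      rw [hlhs, List.getD_eq_getElem?_getD, List.getElem?_map, List.getElem?_eq_getElem hi,
        Option.map_some, Option.getD_some, List.getD_eq_getElem?_getD, List.getElem?_eq_getElem hi,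
        Option.getD_some]
    simp only [vecOf, qent, hz, this, Int.cast_mul, Int.cast_natCast]; ring
  -- right side
  have l1 := length_lincomb 13 (ce.y.map fun y : ℕ => (y : ℤ)) _ hR
  have l2 := length_lincomb 13 ce.w _ hB
  have l3 := length_lincomb 13 ce.wp _ hO
  have l12 : (vadd (lincomb 13 (ce.y.map fun y : ℕ => (y : ℤ)) (rc.R.map rowAz)) (lincomb 13 ce.w (BB.map rowAz))).length = 13 := by
    rw [length_vadd _ _ (by rw [l1, l2]), l1]
  have l123 : (vadd (vadd (lincomb 13 (ce.y.map fun y : ℕ => (y : ℤ)) (rc.R.map rowAz)) (lincomb 13 ce.w (BB.map rowAz)))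
      (lincomb 13 ce.wp [rowOneAff 0, rowOneAff 1, rowOneAff 2])).length = 13 := by
    rw [length_vadd _ _ (by rw [l12, l3]), l12]
  have ls : ((List.range 13).map fun i => if i = 12 then (ce.s : ℤ) else 0).length = 13 := by simp
  have hr : vecOf 13 rhs = ((List.zip ce.y rc.R).map fun p => ((p.1 : ℕ) : ℚ) • hz p.2).sum +
      ((List.zip ce.w BB).map fun p => (p.1 : ℚ) • hz p.2).sum +
      ((List.zip ce.wp [0, 1, 2]).map fun p => (p.1 : ℚ) • hE p.2).sum +
      (fun i : Fin 13 => if (i : ℕ) = 12 then (ce.s : ℚ) else 0) := by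
    rw [hrhs, vecOf_vadd 13 _ _ l123 ls, vecOf_vadd 13 _ _ l12 l3, vecOf_vadd 13 _ _ l1 l2,
      vecOf_lincomb 13 _ _ hR, vecOf_lincomb 13 _ _ hB, vecOf_lincomb 13 _ _ hO]
    congr 1
    · congr 1
      · congr 1
        · rw [zip_map_left', zip_map_right', List.map_map, List.map_map]
          refine congrArg List.sum (List.map_congr_left fun p _ => ?_); simp [vecOf_rowAz_13]
        · rw [zip_map_right', List.map_map]
          refine congrArg List.sum (List.map_congr_left fun p _ => ?_); simp [vecOf_rowAz_13]
      · rw [show ([rowOneAff 0, rowOneAff 1, rowOneAff 2] : List (List ℤ)) = ([0, 1, 2] : List ℕ).map rowOneAff from rfl,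
          zip_map_right', List.map_map]
        refine congrArg List.sum (List.map_congr_left fun p _ => ?_); simp [vecOf_rowOneAff]
    · funext i
      simp only [vecOf, qent, List.getD_eq_getElem?_getD, List.getElem?_map, List.getElem?_range i.2,
        Option.map_some, Option.getD_some]
      split_ifs <;> simp
  rw [hl, hr, add_dotProduct, add_dotProduct, add_dotProduct, list_sum_dotProduct, list_sum_dotProduct,
    list_sum_dotProduct, List.map_map, List.map_map, List.map_map] at hpair
  rw [hpair]
  have hs : (fun i : Fin 13 => if (i : ℕ) = 12 then (ce.s : ℚ) else 0) ⬝ᵥ hx x = ce.s := by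
    rw [dot_hx]
    have h0 : linPart (fun i : Fin 13 => if (i : ℕ) = 12 then (ce.s : ℚ) else 0) = 0 := by
      funext i; have : (i : ℕ) ≠ 12 := by omega
      simp [linPart, this]
    rw [h0, zero_dotProduct, zero_add]; simp
  rw [hs]
  congr 1; congr 1; congr 1
  · refine congrArg List.sum (List.map_congr_left fun p _ => ?_)
    simp [gq, smul_dotProduct]
  · refine congrArg List.sum (List.map_congr_left fun p _ => ?_)
    simp [gq, smul_dotProduct]
  · refine congrArg List.sum (List.map_congr_left fun p _ => ?_)
    simp [smul_dotProduct]

end BoundCert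

/-! ### The rank certificate: an inverse modulo a prime gives a non-zero determinant -/

section RankCert

/-- Auxiliary lemma `invCertAux_spec`. [folklore] -/
theorem invCertAux_spec (X : List (List ℤ)) :
    ∀ (ps : List ℕ) {p : ℕ} {N : List (List ℕ)}, invCertAux X ps = some (p, N) →
      p ∈ ps ∧ checkInvMod p X N X.length = true
  | [], p, N, h => by simp [invCertAux] at h
  | q :: ps, p, N, h => by
    simp only [invCertAux] at h
    split at h
    · rename_i N' hN'
      split_ifs at h with hc
      · simp only [Option.some.injEq, Prod.mk.injEq] at h
        obtain ⟨rfl, rfl⟩ := h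
        exact ⟨List.mem_cons_self, hc⟩
      · have := invCertAux_spec X ps h
        exact ⟨List.mem_cons_of_mem _ this.1, this.2⟩
    · have := invCertAux_spec X ps h
      exact ⟨List.mem_cons_of_mem _ this.1, this.2⟩

/-- Auxiliary lemma `prime_of_mem_primes`. [folklore] -/
theorem prime_of_mem_primes {p : ℕ} (h : p ∈ primes) : p.Prime := by
  simp only [primes, List.mem_cons, List.mem_nil_iff, or_false] at h
  rcases h with rfl | rfl | rfl <;> norm_num

/-- Entries of `zipWith` of natural-number lists of equal length. [folklore] -/
theorem getD_zipWith_nat {f : ℕ → ℕ → ℕ} (hf : f 0 0 = 0) : ∀ (u v : List ℕ) (i : ℕ),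
    u.length = v.length → (List.zipWith f u v).getD i 0 = f (u.getD i 0) (v.getD i 0)
  | [], [], i, _ => by simp [hf]
  | a :: u, b :: v, 0, _ => by simp
  | a :: u, b :: v, i + 1, h => by
    simp only [List.zipWith_cons_cons, List.getD_cons_succ]
    exact getD_zipWith_nat hf u v i (by simpa using h)
  | [], _ :: _, _, h => by simp at h
  | _ :: _, [], _, h => by simp at h

/-- **Semantics of `mulRowMod`** before reduction: entry `j` of `∑ₖ rowₖ • Nₖ`. [folklore] -/
theorem mulRow_spec (r : ℕ) (row : List ℕ) (N : List (List ℕ)) (hN : ∀ nr ∈ N, nr.length = r) :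
    ((List.zip row N).foldr (fun cn acc => List.zipWith (fun a b => cn.1 * a + b) cn.2 acc)
        ((List.range r).map fun _ => 0)).length = r ∧
    ∀ j, ((List.zip row N).foldr (fun cn acc => List.zipWith (fun a b => cn.1 * a + b) cn.2 acc)
        ((List.range r).map fun _ => 0)).getD j 0 =
      ((List.zip row N).map fun cn => cn.1 * cn.2.getD j 0).sum := by
  generalize hz : List.zip row N = zs
  have hzs : ∀ cn ∈ zs, cn.2.length = r := by
    intro cn hcn; rw [← hz] at hcn; exact hN _ (List.of_mem_zip hcn).2
  clear hz hN
  induction zs with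
  | nil =>
    refine ⟨by simp, fun j => ?_⟩
    simp only [List.foldr_nil, List.map_nil, List.sum_nil, List.getD_eq_getElem?_getD, List.getElem?_map]
    by_cases hj : j < r
    · rw [List.getElem?_range hj]; rfl
    · rw [List.getElem?_eq_none (by simp; omega)]; rfl
  | cons cn zs ih =>
    obtain ⟨ihl, ihg⟩ := ih (fun x hx => hzs x (List.mem_cons_of_mem _ hx))
    have hl : cn.2.length = (List.foldr (fun cn acc => List.zipWith (fun a b => cn.1 * a + b) cn.2 acc)
        ((List.range r).map fun _ => 0) zs).length := by
      rw [ihl]; exact hzs cn List.mem_cons_self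
    refine ⟨by rw [List.foldr_cons, List.length_zipWith, hl, min_self, ← hl, hzs cn List.mem_cons_self], fun j => ?_⟩
    rw [List.foldr_cons, getD_zipWith_nat (f := fun a b => cn.1 * a + b) (by simp) _ _ j hl, ihg j,
      List.map_cons, List.sum_cons]

/-- A zipped sum over two lists of length `r` as a sum over `Fin r`. [folklore] -/
theorem zip_sum_eq_fin_sum (r : ℕ) : ∀ (u : List ℕ) (N : List (List ℕ)) (j : ℕ),
    u.length = r → N.length = r →
    ((List.zip u N).map fun cn => cn.1 * cn.2.getD j 0).sum =
      ∑ k : Fin r, u.getD k 0 * (N.getD k []).getD j 0 := by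
  induction r with
  | zero => intro u N j hu hN; rw [List.length_eq_zero_iff] at hu; subst hu; simp
  | succ r ih =>
    intro u N j hu hN
    match u, N, hu, hN with
    | a :: u, nr :: N, hu, hN =>
      simp only [List.length_cons, Nat.add_right_cancel_iff] at hu hN
      rw [List.zip_cons_cons, List.map_cons, List.sum_cons, ih u N j hu hN, Fin.sum_univ_succ]
      simp

/-- The square integer matrix of a list of rows. [folklore] -/
def matOf (r : ℕ) (X : List (List ℤ)) : Matrix (Fin r) (Fin r) ℤ := fun i j => (X.getD i []).getD j 0

/-- The square natural-number matrix of a list of rows. [folklore] -/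
def matOfN (r : ℕ) (N : List (List ℕ)) : Matrix (Fin r) (Fin r) ℕ := fun i j => (N.getD i []).getD j 0

/-- Auxiliary lemma `zmodp_cast`. [folklore] -/
theorem zmodp_cast (p : ℕ) (x : ℤ) (hp : 0 < p) : ((zmodp p x : ℕ) : ZMod p) = (x : ZMod p) := by
  rw [zmodp]
  have h0 : 0 ≤ x % (p : ℤ) := Int.emod_nonneg _ (by exact_mod_cast hp.ne')
  have : ((Int.toNat (x % (p : ℤ)) : ℕ) : ℤ) = x % (p : ℤ) := Int.toNat_of_nonneg h0
  rw [← Int.cast_natCast (R := ZMod p), this, ZMod.intCast_mod]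

/-- **Semantics of `checkInvMod`**: `X N = 1` over `ZMod p`. [folklore] -/
theorem matOf_mul_eq_one {p r : ℕ} (hp : 0 < p) (X : List (List ℤ)) (N : List (List ℕ))
    (h : checkInvMod p X N r = true) :
    ((matOf r X).map (Int.cast : ℤ → ZMod p)) * ((matOfN r N).map (Nat.cast : ℕ → ZMod p)) = 1 := by
  simp only [checkInvMod, Bool.and_eq_true, beq_iff_eq, List.all_eq_true, decide_eq_true_eq] at h
  obtain ⟨⟨⟨⟨⟨hXl, hNl⟩, hXr⟩, hNr⟩, -⟩, hall⟩ := h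
  ext i j
  have hi : i.1 < X.length := by rw [hXl]; exact i.2
  have hXi : X.getD i [] = X[i.1] := by
    rw [List.getD_eq_getElem?_getD, List.getElem?_eq_getElem hi, Option.getD_some]
  -- the pair `((X[i]).map (zmodp p), i)` is in the zipped list
  have hmem : ((X[i.1]).map (zmodp p), i.1) ∈ List.zip (X.map fun row => row.map (zmodp p)) (List.range r) := by
    rw [List.mem_iff_getElem]
    refine ⟨i.1, by simp [hXl], ?_⟩
    rw [List.getElem_zip]; simp
  have hrow := hall _ hmem
  have hmem2 : ((mulRowMod p ((X[i.1]).map (zmodp p)) N r).getD j 0, j.1) ∈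
      List.zip (mulRowMod p ((X[i.1]).map (zmodp p)) N r) (List.range r) := by
    have hlen : (mulRowMod p ((X[i.1]).map (zmodp p)) N r).length = r := by
      rw [mulRowMod, List.length_map]; exact (mulRow_spec r _ N hNr).1
    rw [List.mem_iff_getElem]
    refine ⟨j.1, by simp [hlen], ?_⟩
    rw [List.getElem_zip]
    simp only [List.getElem_range, Prod.mk.injEq, and_true]
    rw [List.getD_eq_getElem?_getD, List.getElem?_eq_getElem (by rw [hlen]; exact j.2), Option.getD_some]
  have hent := hrow _ hmem2
  have hlen : (mulRowMod p ((X[i.1]).map (zmodp p)) N r).length = r := by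
    rw [mulRowMod, List.length_map]; exact (mulRow_spec r _ N hNr).1
  have hinner_len := (mulRow_spec r ((X[i.1]).map (zmodp p)) N hNr).1
  have hsum := (mulRow_spec r ((X[i.1]).map (zmodp p)) N hNr).2 j.1
  rw [zip_sum_eq_fin_sum r _ _ _ (by rw [List.length_map, hXr _ (List.getElem_mem hi)]) hNl] at hsum
  have hjl : j.1 < (mulRowMod p ((X[i.1]).map (zmodp p)) N r).length := by rw [hlen]; exact j.2
  dsimp only at hent
  rw [List.getD_eq_getElem?_getD, List.getElem?_eq_getElem hjl, Option.getD_some] at hent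
  have hmod : (mulRowMod p ((X[i.1]).map (zmodp p)) N r)[j.1] =
      (∑ k : Fin r, ((X[i.1]).map (zmodp p)).getD k 0 * (N.getD k []).getD j 0) % p := by
    rw [← hsum]
    simp only [mulRowMod, List.getElem_map]
    rw [List.getD_eq_getElem?_getD, List.getElem?_eq_getElem (by rw [hinner_len]; exact j.2),
      Option.getD_some]
  rw [hmod] at hent
  -- cast to `ZMod p`
  have hcast := congrArg (fun n : ℕ => (n : ZMod p)) hent
  simp only [ZMod.natCast_mod, Nat.cast_sum, Nat.cast_mul, Nat.cast_ite, Nat.cast_one, Nat.cast_zero] at hcast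
  rw [Matrix.mul_apply, Matrix.one_apply]
  rw [show (if i = j then (1 : ZMod p) else 0) = if i.1 = j.1 then 1 else 0 by
    simp [Fin.ext_iff]]
  rw [← hcast]
  refine Finset.sum_congr rfl fun k _ => ?_
  simp only [Matrix.map_apply, matOf, matOfN, hXi]
  congr 1
  by_cases hk : k.1 < (X[i.1]).length
  · rw [List.getD_eq_getElem?_getD, List.getElem?_eq_getElem hk, Option.getD_some,
      List.getD_eq_getElem?_getD, List.getElem?_map, List.getElem?_eq_getElem hk, Option.map_some,
      Option.getD_some, zmodp_cast p _ hp]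
  · rw [List.getD_eq_getElem?_getD, List.getElem?_eq_none (not_lt.1 hk), Option.getD_none,
      List.getD_eq_getElem?_getD, List.getElem?_map, List.getElem?_eq_none (not_lt.1 hk), Option.map_none,
      Option.getD_none]
    simp

/-- **Soundness of the rank certificate**: the rational matrix of `X` has non-zero determinant.
[folklore] -/
theorem det_ne_zero_of_invCert (X : List (List ℤ)) (h : (invCert X).isSome = true) :
    ((matOf X.length X).map (Int.cast : ℤ → ℚ)).det ≠ 0 := by
  rw [Option.isSome_iff_exists] at h
  obtain ⟨⟨p, N⟩, hpN⟩ := h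
  obtain ⟨hp, hc⟩ := invCertAux_spec X primes hpN
  have hprime := prime_of_mem_primes hp
  haveI : Fact p.Prime := ⟨hprime⟩
  have hmul := matOf_mul_eq_one hprime.pos X N hc
  have hunit : IsUnit ((matOf X.length X).map (Int.cast : ℤ → ZMod p)).det :=
    Matrix.isUnit_det_of_right_inverse hmul
  have hZ : (matOf X.length X).det ≠ 0 := by
    intro h0
    have : ((matOf X.length X).map (Int.cast : ℤ → ZMod p)).det = 0 := by
      have := RingHom.map_det (Int.castRingHom (ZMod p)) (matOf X.length X)
      rw [h0, map_zero] at this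
      rw [show (matOf X.length X).map (Int.cast : ℤ → ZMod p) =
        (Int.castRingHom (ZMod p)).mapMatrix (matOf X.length X) from rfl]
      exact this.symm
    exact not_isUnit_zero (this ▸ hunit)
  intro h0
  apply hZ
  have := RingHom.map_det (Int.castRingHom ℚ) (matOf X.length X)
  rw [show (matOf X.length X).map (Int.cast : ℤ → ℚ) = (Int.castRingHom ℚ).mapMatrix (matOf X.length X)
    from rfl] at h0
  rw [h0] at this
  rw [eq_intCast] at this
  exact_mod_cast this

end RankCert

/-! ### The direction matrix of a face -/

section DirMatrix

/-- Entries of `matOf` for a list of rows given by `map`. [folklore] -/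
theorem getD_map_getD {α β : Type*} (l : List α) (f : α → β) (d : β) (i : ℕ) (hi : i < l.length) (a0 : α) :
    (l.map f).getD i d = f (l.getD i a0) := by
  rw [List.getD_eq_getElem?_getD, List.getElem?_map, List.getElem?_eq_getElem hi, Option.map_some,
    Option.getD_some, List.getD_eq_getElem?_getD, List.getElem?_eq_getElem hi, Option.getD_some]

/-- Auxiliary lemma `qent_take12`. [folklore] -/
theorem qent_take12 (l : List ℤ) (i : ℕ) (hi : i < 12) : qent (l.take 12) i = qent l i := by
  simp only [qent, List.getD_eq_getElem?_getD, List.getElem?_take, if_pos hi]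

/-- `dotL (rowA k) ((rowVert r).take 12) = Aₖ · lin(hv r)`. [folklore] -/
theorem dotL_rowA_take (k r : ℕ) :
    (dotL (rowA k) ((rowVert r).take 12) : ℚ) = aq k ⬝ᵥ linPart (hv r) := by
  rw [dotL_eq_sum 12 _ _ (length_rowA k) (by simp [length_rowVert])]
  refine Finset.sum_congr rfl fun i _ => ?_
  have h1 : qent (rowA k) i = aq k i := by simp only [aq, qent, getD_rowA k i i.2]
  have h2 : qent ((rowVert r).take 12) i = linPart (hv r) i := by
    rw [qent_take12 _ _ i.2]; rfl
  rw [h1, h2]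

/-- **Consequence of the direction-matrix certificate.** If `c` are coefficients of the
homogenised basis vertices such that the combination has last coordinate `0` and its linear part
is orthogonal to the first `d` rows of `R`, then `c = 0`. [folklore] -/
theorem dir_coeff_eq_zero (rc : Rec) (d : ℕ) (hbl : rc.basis.length = d + 1) (hd : d ≤ rc.R.length)
    (hdir : (invCert (dirMatrix ((((rc.R.map rowAz).map fun row => row.take 12)).take d)
      (rc.basis.map rowVert))).isSome = true)
    (c : Fin (d + 1) → ℚ)
    (h1 : ∀ i : Fin (d + 1), (i : ℕ) < d →
      aq (rc.R.getD i 0) ⬝ᵥ linPart (∑ j : Fin (d + 1), c j • hv (rc.basis.getD j 0)) = 0)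
    (h2 : (∑ j : Fin (d + 1), c j • hv (rc.basis.getD j 0)) (Fin.last 12) = 0) : c = 0 := by
  set X := dirMatrix ((((rc.R.map rowAz).map fun row => row.take 12)).take d) (rc.basis.map rowVert)
    with hX
  have hfront_len : ((((rc.R.map rowAz).map fun row => row.take 12)).take d).length = d := by
    simp only [List.length_take, List.length_map]; omega
  have hXl : X.length = d + 1 := by
    rw [hX, dirMatrix, List.length_append, List.length_map, hfront_len, List.length_singleton]
  have hdet := det_ne_zero_of_invCert X hdir
  rw [hXl] at hdet
  refine Matrix.eq_zero_of_mulVec_eq_zero hdet ?_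
  funext i
  rw [Matrix.mulVec, dotProduct, Pi.zero_apply]
  -- entries of row `i`
  by_cases hi : (i : ℕ) < d
  · -- a direction row
    have hrow : X.getD i [] = (rc.basis.map rowVert).map fun v => dotL (rowA (rc.R.getD i 0)) (v.take 12) := by
      rw [hX, dirMatrix, List.getD_eq_getElem?_getD,
        List.getElem?_append_left (by rw [List.length_map, hfront_len]; exact hi), List.getElem?_map,
        List.getElem?_take, if_pos hi, List.getElem?_map, List.getElem?_map,
        List.getElem?_eq_getElem (lt_of_lt_of_le hi hd)]
      simp only [Option.map_some, Option.getD_some]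
      congr 1; funext v
      rw [rowA, List.getD_eq_getElem?_getD, List.getElem?_eq_getElem (lt_of_lt_of_le hi hd), Option.getD_some]
    have hent : ∀ j : Fin (d + 1), ((matOf (d + 1) X).map (Int.cast : ℤ → ℚ)) i j =
        aq (rc.R.getD i 0) ⬝ᵥ linPart (hv (rc.basis.getD j 0)) := by
      intro j
      simp only [Matrix.map_apply, matOf, hrow]
      rw [List.map_map, getD_map_getD _ _ _ _ (by rw [hbl]; exact j.2) 0]
      exact dotL_rowA_take _ _
    simp only [hent]
    rw [← h1 i hi]
    simp only [linPart, Finset.sum_apply, Pi.smul_apply, smul_eq_mul, dotProduct, Finset.mul_sum]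
    rw [Finset.sum_comm]
    refine Finset.sum_congr rfl fun j _ => ?_
    rw [Finset.sum_mul]
    refine Finset.sum_congr rfl fun l _ => ?_
    ring
  · -- the denominator row
    have hid : (i : ℕ) = d := by omega
    have hrow : X.getD i [] = (rc.basis.map rowVert).map fun v => ent v 12 := by
      rw [hX, dirMatrix, List.getD_eq_getElem?_getD,
        List.getElem?_append_right (by rw [List.length_map, hfront_len]; omega), List.length_map,
        hfront_len, hid, Nat.sub_self]
      simp
    have hent : ∀ j : Fin (d + 1), ((matOf (d + 1) X).map (Int.cast : ℤ → ℚ)) i j =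
        hv (rc.basis.getD j 0) (Fin.last 12) := by
      intro j
      simp only [Matrix.map_apply, matOf, hrow]
      rw [List.map_map, getD_map_getD _ _ _ _ (by rw [hbl]; exact j.2) 0]
      rfl
    simp only [hent]
    rw [← h2]
    simp only [Finset.sum_apply, Pi.smul_apply, smul_eq_mul]
    refine Finset.sum_congr rfl fun j _ => ?_
    ring

end DirMatrix

/-! ### Structural lemmas: records and public data, chunks and nodes -/

section Structural

/-- Auxiliary lemma `rdRec_pub`. [folklore] -/
theorem rdRec_pub (pb : Pub) (l : List ℕ) :
    (⟨(rdRec pb l).1.apex, (rdRec pb l).1.B, (rdRec pb l).1.R, (rdRec pb l).1.basis⟩ : Pub) = pb := by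
  cases pb; rfl

/-- Auxiliary lemma `rdRecs_ifc`. [folklore] -/
theorem rdRecs_ifc : ∀ (n c q : ℕ) (l : List ℕ) (rc : Rec), (rdRecs n c l)[q]? = some rc →
    ifcEntry (c + q) = some ⟨rc.apex, rc.B, rc.R, rc.basis⟩
  | 0, c, q, l, rc, h => by simp [rdRecs] at h
  | n + 1, c, q, l, rc, h => by
    simp only [rdRecs] at h
    split at h
    · simp at h
    · rename_i pb hpb
      cases q with
      | zero =>
        simp only [List.getElem?_cons_zero, Option.some.injEq] at h
        rw [add_zero, hpb, ← h, rdRec_pub]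
      | succ q =>
        rw [List.getElem?_cons_succ] at h
        have := rdRecs_ifc n (c + 1) q _ rc h
        rwa [add_assoc, add_comm 1 q] at this

/-- The public data of a node are those of its record. [folklore] -/
theorem ifcEntry_of_node (c : ℕ) (rc : Rec) (h : node c = some rc) :
    ifcEntry c = some ⟨rc.apex, rc.B, rc.R, rc.basis⟩ := by
  unfold node chunkRecs at h
  have := rdRecs_ifc NPC (NPC * (c / NPC)) (c % NPC) _ rc h
  rwa [Nat.div_add_mod] at this

/-- Auxiliary lemma `checkRecs_get`. [folklore] -/
theorem checkRecs_get : ∀ (cnt m : ℕ) (rcs : List Rec), checkRecs m cnt rcs = true →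
    ∀ q, q < cnt → ∃ rc, rcs[q]? = some rc ∧ checkNodeRec (m + q) rc = true
  | 0, m, rcs, _, q, hq => absurd hq (Nat.not_lt_zero _)
  | cnt + 1, m, [], h, q, _ => by simp [checkRecs] at h
  | cnt + 1, m, rc :: rcs, h, q, hq => by
    simp only [checkRecs, Bool.and_eq_true] at h
    cases q with
    | zero => exact ⟨rc, rfl, by simpa using h.1⟩
    | succ q =>
      obtain ⟨rc', h1, h2⟩ := checkRecs_get cnt (m + 1) rcs h.2 q (by omega)
      refine ⟨rc', by simpa using h1, ?_⟩
      rwa [add_assoc, add_comm 1 q] at h2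

/-- Auxiliary lemma `NPC_pos`. [folklore] -/
theorem NPC_pos : 0 < NPC := by simp [NPC]

/-- **A checked chunk checks its nodes.** [folklore] -/
theorem checkNode_of_checkChunk (j cnt : ℕ) (h : checkChunk j cnt = true) (q : ℕ) (hq : q < cnt)
    (hqN : q < NPC) : checkNode (NPC * j + q) = true := by
  obtain ⟨rc, hrc, hc⟩ := checkRecs_get cnt (NPC * j) (chunkRecs j) h q hq
  have h1 : (NPC * j + q) / NPC = j := by
    rw [Nat.add_comm, Nat.add_mul_div_left _ _ NPC_pos, Nat.div_eq_of_lt hqN, zero_add]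
  have h2 : (NPC * j + q) % NPC = q := by
    rw [Nat.add_comm, Nat.add_mul_mod_self_left, Nat.mod_eq_of_lt hqN]
  unfold checkNode node
  rw [h1, h2, hrc]
  exact hc

end Structural

/-! ## §4 The node checks as propositions -/

section NodeFacts

/-- A member of a list zipped with its image. [folklore] -/
theorem mem_zip_map_self {α β : Type*} (f : α → β) :
    ∀ (l : List α) {a : α}, a ∈ l → (a, f a) ∈ List.zip l (l.map f)
  | [], _, ha => absurd ha List.not_mem_nil
  | b :: l, a, ha => by
    rw [List.map_cons, List.zip_cons_cons, List.mem_cons]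
    rcases List.mem_cons.1 ha with rfl | ha
    · exact Or.inl rfl
    · exact Or.inr (mem_zip_map_self f l ha)

/-- A member of the right list of a `zip` of lists of equal lengths has a partner. [folklore] -/
theorem exists_mem_zip_left {α β : Type*} : ∀ (ys : List α) (l : List β) {k : β},
    ys.length = l.length → k ∈ l → ∃ y, y ∈ ys ∧ (y, k) ∈ List.zip ys l
  | [], [], _, _, hk => absurd hk List.not_mem_nil
  | [], _ :: _, _, h, _ => absurd h (by simp)
  | _ :: _, [], _, h, _ => absurd h (by simp)
  | y :: ys, b :: l, k, h, hk => by
    rcases List.mem_cons.1 hk with rfl | hk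
    · exact ⟨y, List.mem_cons_self, by simp⟩
    · obtain ⟨y', hy', hmem⟩ := exists_mem_zip_left ys l (by simpa using h) hk
      exact ⟨y', List.mem_cons_of_mem _ hy', by
        rw [List.zip_cons_cons]; exact List.mem_cons_of_mem _ hmem⟩

/-- An entry of a list (within range) is a member. [folklore] -/
theorem getD_mem_of_lt {α : Type*} (l : List α) (d : α) {i : ℕ} (hi : i < l.length) : l.getD i d ∈ l := by
  rw [List.getD_eq_getElem?_getD, List.getElem?_eq_getElem hi, Option.getD_some]
  exact List.getElem_mem hi

/-- **The facts certified by `checkNodeRec m rc`**, as propositions. [folklore] -/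
structure NodeOK (m : ℕ) (rc : Rec) : Prop where
  apex_lt : rc.apex < nV
  B_lt : ∀ b ∈ rc.B, b < nF
  R_lt : ∀ k ∈ rc.R, k < nF
  basis_lt : ∀ r ∈ rc.basis, r < nV
  B_len : rc.B.length ≤ 9
  basis_len : rc.basis.length = (9 - rc.B.length) + 1
  d_le : 9 - rc.B.length ≤ rc.R.length
  tree : checkTree m rc = true
  cbasis : checkBasis rc (rowVert rc.apex) = true
  apex_B : ∀ b ∈ rc.B, dotL (rowAz b) (rowVert rc.apex) = 0
  apex_R : ∀ k ∈ rc.R, 0 ≤ dotL (rowAz k) (rowVert rc.apex)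
  basis_B : ∀ r ∈ rc.basis, ∀ b ∈ rc.B, dotL (rowAz b) (rowVert r) = 0
  bound : checkBound rc (rc.R.map rowA) (rc.B.map rowA) = true
  dir : (invCert (dirMatrix ((((rc.R.map rowAz).map fun row => row.take 12)).take (9 - rc.B.length))
      (rc.basis.map rowVert))).isSome = true
  cover : ∀ k ∈ rc.R, dotL (rowAz k) (rowVert rc.apex) = 0 ∨ ∃ kd ∈ rc.kids, kd.k = k
  kids : ∀ kd ∈ rc.kids, checkKid m rc (rc.R.map rowAz) (rc.B.map rowAz) kd = true

/-- `checkNodeRec` establishes `NodeOK`. [folklore] -/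
theorem nodeOK_of_check {m : ℕ} {rc : Rec} (h : checkNodeRec m rc = true) : NodeOK m rc := by
  have hRA : ((rc.R.map rowAz).map fun row => row.take 12) = rc.R.map rowA := by
    rw [List.map_map]; rfl
  have hBA : ((rc.B.map rowAz).map fun row => row.take 12) = rc.B.map rowA := by
    rw [List.map_map]; rfl
  simp only [checkNodeRec, Bool.and_eq_true, List.all_eq_true, decide_eq_true_eq, beq_iff_eq,
    Bool.or_eq_true, List.any_eq_true, List.forall_mem_map, gAtL] at h
  obtain ⟨⟨⟨⟨⟨⟨⟨⟨⟨⟨⟨⟨⟨⟨⟨hapex, hB⟩, hR⟩, hbasis⟩, hBlen⟩, hblen⟩, hdle⟩, htree⟩, hcb⟩, hapexB⟩,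
    hapexR⟩, hbasisB⟩, hbound⟩, hdir⟩, hcover⟩, hkids⟩ := h
  refine ⟨hapex, hB, hR, hbasis, hBlen, hblen, hdle, htree, hcb, hapexB, hapexR, hbasisB, ?_, hdir, ?_, hkids⟩
  · rw [hRA, hBA] at hbound; exact hbound
  · intro k hk
    have := hcover _ (mem_zip_map_self rowAz rc.R hk)
    exact this

/-- **The facts certified by `checkKid`** (child `kd` of node `m`, public data `cc`). [folklore] -/
structure KidOK (m : ℕ) (rc : Rec) (kd : Kid) (cc : Pub) : Prop where
  lt : m < kd.c
  c_lt : kd.c < numNodes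
  ifc : ifcEntry kd.c = some cc
  basis_lt : ∀ r ∈ cc.basis, r < nV
  basis_B : ∀ r ∈ cc.basis, ∀ b ∈ rc.B, dotL (rowAz b) (rowVert r) = 0
  basis_k : ∀ r ∈ cc.basis, dotL (rowAz kd.k) (rowVert r) = 0
  count : 13 ≤ rc.B.length + 4 + cc.basis.length
  cover : ∀ k' ∈ cc.R, k' ∈ rc.R ∨ k' ∈ rc.B ∨ k' = kd.k ∨
    ∃ ce ∈ kd.certs, ce.row = k' ∧ checkCert rc (rc.R.map rowAz) ((rc.B ++ [kd.k]).map rowAz) ce = true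

/-- `checkKid` establishes `KidOK`. [folklore] -/
theorem kidOK_of_check {m : ℕ} {rc : Rec} {kd : Kid}
    (h : checkKid m rc (rc.R.map rowAz) (rc.B.map rowAz) kd = true) : ∃ cc, KidOK m rc kd cc := by
  unfold checkKid at h
  cases hc : ifcEntry kd.c with
  | none => rw [hc] at h; simp at h
  | some cc =>
    rw [hc] at h
    simp only [Bool.and_eq_true, List.all_eq_true, decide_eq_true_eq, beq_iff_eq, Bool.or_eq_true,
      List.any_eq_true, List.forall_mem_map, gAtL, List.contains_iff_mem] at h
    obtain ⟨⟨hlt, hclt⟩, ⟨⟨⟨⟨hbl, hbB⟩, hbk⟩, hcount⟩, hcov⟩⟩ := h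
    refine ⟨cc, hlt, hclt, hc, hbl, hbB, hbk, hcount, ?_⟩
    intro k' hk'
    have hmap : rc.B.map rowAz ++ [rowAz kd.k] = (rc.B ++ [kd.k]).map rowAz := by simp
    rcases hcov k' hk' with ((h1 | h1) | h1) | ⟨ce, hce, hrow, hcert⟩
    · exact Or.inl h1
    · exact Or.inr (Or.inl h1)
    · exact Or.inr (Or.inr (Or.inl h1))
    · exact Or.inr (Or.inr (Or.inr ⟨ce, hce, hrow, by rw [← hmap]; exact hcert⟩))

/-- **The facts certified by `checkTree`** at a non-root node. [folklore] -/
theorem treeOK_of_check {m : ℕ} {rc : Rec} (hm : m ≠ 0) (h : checkTree m rc = true) :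
    ∃ pp : Pub, 0 < rc.par ∧ rc.par - 1 < m ∧ 0 < rc.kcut ∧ rc.kcut - 1 < nF ∧
      ifcEntry (rc.par - 1) = some pp ∧ rc.B = pp.B ++ [rc.kcut - 1] ∧ pp.apex < nV ∧
      dotL (rowAz (rc.kcut - 1)) (rowVert pp.apex) ≠ 0 := by
  unfold checkTree at h
  rw [if_neg hm] at h
  cases hc : ifcEntry (rc.par - 1) with
  | none => rw [hc] at h; simp at h
  | some pp =>
    rw [hc] at h
    simp only [Bool.and_eq_true, decide_eq_true_eq, beq_iff_eq, bne_iff_ne, ne_eq, gAtL] at h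
    obtain ⟨⟨⟨⟨h1, h2⟩, h3⟩, h4⟩, ⟨⟨h5, h6⟩, h7⟩⟩ := h
    exact ⟨pp, h1, h2, h3, h4, rfl, h5, h6, h7⟩

/-- `checkTree` at the root: no equality rows. [folklore] -/
theorem tree_root_of_check {rc : Rec} (h : checkTree 0 rc = true) : rc.B = [] := by
  unfold checkTree at h
  simp only [if_true, Bool.and_eq_true, beq_iff_eq] at h
  exact h.2

/-- **The facts certified by `checkBasis`**: a leaf, or a designated child. [folklore] -/
theorem basisOK_of_check {rc : Rec} (h : checkBasis rc (rowVert rc.apex) = true) :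
    rc.basis = [rc.apex] ∨
      ∃ kd ∈ rc.kids, ∃ cc : Pub, ifcEntry kd.c = some cc ∧ rc.basis = cc.basis ++ [rc.apex] ∧
        dotL (rowAz kd.k) (rowVert rc.apex) ≠ 0 := by
  unfold checkBasis at h
  split_ifs at h with h0
  · simp only [Bool.and_eq_true, beq_iff_eq] at h
    exact Or.inl h.2
  · right
    simp only [Bool.and_eq_true, List.any_eq_true, beq_iff_eq, bne_iff_ne, ne_eq, gAtL] at h
    obtain ⟨kd, hkd, ⟨-, hmatch⟩, hne⟩ := h
    refine ⟨kd, hkd, ?_⟩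
    cases hc : ifcEntry kd.c with
    | none => rw [hc] at hmatch; simp at hmatch
    | some cc =>
      rw [hc] at hmatch
      simp only [beq_iff_eq] at hmatch
      exact ⟨cc, rfl, hmatch, hne⟩

/-- **The facts certified by `checkGlobal`.** [folklore] -/
theorem globalOK_of_check (h : checkGlobal = true) :
    (∀ r, r < nV → 0 < ent (rowVert r) 12 ∧ ∀ t, t < 3 → dotL (rowOneAff t) (rowVert r) = 0) ∧
      ∃ rc0, node 0 = some rc0 ∧ rc0.B = [] ∧ rc0.R.length = nF ∧ ∀ k, k < nF → k ∈ rc0.R := by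
  unfold checkGlobal at h
  cases hc : node 0 with
  | none => rw [hc] at h; simp at h
  | some rc0 =>
    rw [hc] at h
    simp only [Bool.and_eq_true, List.all_eq_true, List.mem_range, decide_eq_true_eq, beq_iff_eq,
      List.contains_iff_mem] at h
    obtain ⟨hv, ⟨⟨hB, hRl⟩, hR⟩⟩ := h
    exact ⟨fun r hr => hv r hr, rc0, rfl, hB, hRl, hR⟩

/-- A checked node has a record passing `checkNodeRec`. [folklore] -/
theorem exists_rec_of_checkNode {c : ℕ} (h : checkNode c = true) :
    ∃ rc, node c = some rc ∧ checkNodeRec c rc = true := by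
  unfold checkNode at h
  cases hc : node c with
  | none => rw [hc] at h; simp at h
  | some rc => rw [hc] at h; exact ⟨rc, rfl, h⟩

end NodeFacts

/-! ### Semantic consequences of the global checks -/

section GlobalSem

/-- The denominator of a listed vertex is positive. [folklore] -/
theorem den_pos (hglob : checkGlobal = true) {r : ℕ} (hr : r < nV) : 0 < qent (rowVert r) 12 := by
  have := ((globalOK_of_check hglob).1 r hr).1
  simp only [ent] at this
  simp only [qent]
  exact_mod_cast this

/-- Auxiliary lemma `den_ne_zero`. [folklore] -/
theorem den_ne_zero (hglob : checkGlobal = true) {r : ℕ} (hr : r < nV) : qent (rowVert r) 12 ≠ 0 :=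
  (den_pos hglob hr).ne'

/-- Listed vertices are normalised: `(1ₜ,-1)·(vᵣ,1) = 0`. [folklore] -/
theorem hE_hx_vq (hglob : checkGlobal = true) {r : ℕ} (hr : r < nV) {t : ℕ} (ht : t < 3) :
    hE t ⬝ᵥ hx (vq r) = 0 :=
  hE_dot_hx_vq t r (den_ne_zero hglob hr) (((globalOK_of_check hglob).1 r hr).2 t ht)

/-- Listed vertices are normalised, homogenised form: `(1ₜ,-1)·(den vᵣ, den) = 0`. [folklore] -/
theorem hE_hv (hglob : checkGlobal = true) {r : ℕ} (hr : r < nV) {t : ℕ} (ht : t < 3) :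
    hE t ⬝ᵥ hv r = 0 := by
  rw [hE_dot_hv, ((globalOK_of_check hglob).1 r hr).2 t ht, Int.cast_zero]

/-- `gₖ(vᵣ) = 0` iff the integer pairing vanishes. [folklore] -/
theorem gq_vq_eq_zero_iff (hglob : checkGlobal = true) {r : ℕ} (hr : r < nV) (k : ℕ) :
    gq k (vq r) = 0 ↔ dotL (rowAz k) (rowVert r) = 0 := by
  rw [gq_vq k r (den_ne_zero hglob hr), mul_eq_zero, inv_eq_zero, or_iff_right (den_ne_zero hglob hr)]
  exact_mod_cast Iff.rfl

/-- `gₖ(vᵣ) ≥ 0` iff the integer pairing is non-negative. [folklore] -/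
theorem gq_vq_nonneg_iff (hglob : checkGlobal = true) {r : ℕ} (hr : r < nV) (k : ℕ) :
    0 ≤ gq k (vq r) ↔ 0 ≤ dotL (rowAz k) (rowVert r) := by
  rw [gq_vq k r (den_ne_zero hglob hr)]
  have hd := den_pos hglob hr
  constructor
  · intro h
    have := (mul_nonneg_iff_of_pos_left (inv_pos.2 hd)).1 h
    exact_mod_cast this
  · intro h
    exact mul_nonneg (inv_pos.2 hd).le (by exact_mod_cast h)

/-- `hz k · hv r = 0` from the integer pairing. [folklore] -/
theorem hz_hv_eq_zero {k r : ℕ} (h : dotL (rowAz k) (rowVert r) = 0) : hz k ⬝ᵥ hv r = 0 := by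
  rw [hz_dot_hv, h, Int.cast_zero]

/-- `hz k · hv r ≠ 0` from the integer pairing. [folklore] -/
theorem hz_hv_ne_zero {k r : ℕ} (h : dotL (rowAz k) (rowVert r) ≠ 0) : hz k ⬝ᵥ hv r ≠ 0 := by
  rw [hz_dot_hv]; exact_mod_cast h

/-- A listed vertex is in `Vset`. [folklore] -/
theorem vq_mem_Vset {r : ℕ} (hr : r < nV) : vq r ∈ Vset := ⟨r, hr, rfl⟩

end GlobalSem

/-! ## §5 Families of functionals and of homogenised vertices -/

section Families

/-- The functionals of a node as a list: the three normalisations, then the equality rows. [folklore] -/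
def Glist (Bl : List ℕ) : List (Fin 13 → ℚ) := [hE 0, hE 1, hE 2] ++ Bl.map hz

/-- The functionals of a node as a family (used with `n = Bl.length + 3`). [folklore] -/
def famG (Bl : List ℕ) (n : ℕ) : Fin n → (Fin 13 → ℚ) := fun i => (Glist Bl).getD i 0

/-- The homogenised basis vertices of a node as a family (used with `n = bs.length`). [folklore] -/
def famP (bs : List ℕ) (n : ℕ) : Fin n → (Fin 13 → ℚ) := fun j => hv (bs.getD j 0)

/-- Auxiliary lemma `length_Glist`. [folklore] -/
theorem length_Glist (Bl : List ℕ) : (Glist Bl).length = Bl.length + 3 := by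
  simp only [Glist, List.length_append, List.length_cons, List.length_nil, List.length_map]; omega

/-- Auxiliary lemma `Glist_append`. [folklore] -/
theorem Glist_append (Bl : List ℕ) (k : ℕ) : Glist (Bl ++ [k]) = Glist Bl ++ [hz k] := by
  simp [Glist]

/-- Every member of the family of functionals has a property shared by the `hE t` and the `hz b`. [folklore] -/
theorem famG_forall (Bl : List ℕ) {n : ℕ} (hn : n = Bl.length + 3) (P : (Fin 13 → ℚ) → Prop)
    (h1 : ∀ t, t < 3 → P (hE t)) (h2 : ∀ b ∈ Bl, P (hz b)) : ∀ i : Fin n, P (famG Bl n i) := by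
  intro i
  have hi : (i : ℕ) < (Glist Bl).length := by rw [length_Glist]; omega
  have hmem : famG Bl n i ∈ Glist Bl := getD_mem_of_lt _ _ hi
  simp only [Glist, List.mem_append, List.mem_cons, List.mem_nil_iff, or_false, List.mem_map] at hmem
  rcases hmem with (h | h | h) | ⟨b, hb, h⟩
  · rw [h]; exact h1 0 (by norm_num)
  · rw [h]; exact h1 1 (by norm_num)
  · rw [h]; exact h1 2 (by norm_num)
  · rw [← h]; exact h2 b hb

/-- Every member of the family of vertices has a property shared by the `hv r`, `r ∈ bs`. [folklore] -/
theorem famP_forall (bs : List ℕ) {n : ℕ} (hn : n = bs.length) (P : (Fin 13 → ℚ) → Prop)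
    (h : ∀ r ∈ bs, P (hv r)) : ∀ j : Fin n, P (famP bs n j) := by
  intro j
  exact h _ (getD_mem_of_lt _ _ (by omega))

/-- `Fin.init` of the family of `Bl ++ [k]` is the family of `Bl`. [folklore] -/
theorem init_famG_append (Bl : List ℕ) (k : ℕ) :
    Fin.init (famG (Bl ++ [k]) (Bl.length + 1 + 3)) = famG Bl (Bl.length + 3) := by
  funext i
  simp only [Fin.init, famG, Fin.val_castSucc, Glist_append]
  rw [List.getD_eq_getElem?_getD, List.getElem?_append_left (by rw [length_Glist]; exact i.2),
    ← List.getD_eq_getElem?_getD]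

/-- The last member of the family of `Bl ++ [k]` is `hz k`. [folklore] -/
theorem famG_append_last (Bl : List ℕ) (k : ℕ) :
    famG (Bl ++ [k]) (Bl.length + 1 + 3) (Fin.last _) = hz k := by
  simp only [famG, Fin.val_last, Glist_append]
  rw [List.getD_eq_getElem?_getD, List.getElem?_append_right (by rw [length_Glist]), length_Glist,
    show Bl.length + 1 + 2 - (Bl.length + 3) = 0 by omega]
  simp

/-- `Fin.init` of the family of `bs ++ [a]` is the family of `bs`. [folklore] -/
theorem init_famP_append (bs : List ℕ) (a : ℕ) :
    Fin.init (famP (bs ++ [a]) (bs.length + 1)) = famP bs bs.length := by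
  funext j
  simp only [Fin.init, famP, Fin.val_castSucc]
  rw [List.getD_eq_getElem?_getD, List.getElem?_append_left j.2, ← List.getD_eq_getElem?_getD]

/-- The last member of the family of `bs ++ [a]` is `hv a`. [folklore] -/
theorem famP_append_last (bs : List ℕ) (a : ℕ) :
    famP (bs ++ [a]) (bs.length + 1) (Fin.last _) = hv a := by
  simp only [famP, Fin.val_last]
  rw [List.getD_eq_getElem?_getD, List.getElem?_append_right le_rfl, Nat.sub_self]
  simp

/-- A vector pairing non-trivially with `q` is outside the span of vectors orthogonal to `q`. [folklore] -/
theorem notMem_span_of_dot {ι : Type*} (g : ι → Fin 13 → ℚ) (q f : Fin 13 → ℚ)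
    (hg : ∀ i, g i ⬝ᵥ q = 0) (hf : f ⬝ᵥ q ≠ 0) : f ∉ Submodule.span ℚ (Set.range g) := by
  intro hmem
  apply hf
  refine Submodule.span_induction (p := fun w _ => w ⬝ᵥ q = 0) ?_ ?_ ?_ ?_ hmem
  · rintro _ ⟨i, rfl⟩; exact hg i
  · exact zero_dotProduct q
  · intro a b _ _ ha hb; rw [add_dotProduct, ha, hb, add_zero]
  · intro c a _ ha; rw [smul_dotProduct, ha, smul_zero]

/-- **Extending an independent family of functionals by a row**: if all `hE t` and `hz b`
(`b ∈ Bl`) vanish at `q` but `hz k` does not, independence passes from `Bl` to `Bl ++ [k]`.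
[folklore] -/
theorem famG_append_indep (Bl : List ℕ) (k : ℕ) (h : LinearIndependent ℚ (famG Bl (Bl.length + 3)))
    (q : Fin 13 → ℚ) (hq : ∀ t, t < 3 → hE t ⬝ᵥ q = 0) (hqB : ∀ b ∈ Bl, hz b ⬝ᵥ q = 0)
    (hk : hz k ⬝ᵥ q ≠ 0) : LinearIndependent ℚ (famG (Bl ++ [k]) (Bl.length + 1 + 3)) := by
  rw [linearIndependent_finSucc', init_famG_append, famG_append_last]
  exact ⟨h, notMem_span_of_dot _ q _ (famG_forall Bl rfl (fun w => w ⬝ᵥ q = 0) hq hqB) hk⟩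

/-- **Extending an independent family of vertices by an apex**: if `hz k` vanishes on the `hv r`
(`r ∈ bs`) but not at `hv a`, independence passes from `bs` to `bs ++ [a]`. [folklore] -/
theorem famP_append_indep (bs : List ℕ) (a k : ℕ) (h : LinearIndependent ℚ (famP bs bs.length))
    (hk : ∀ r ∈ bs, hz k ⬝ᵥ hv r = 0) (hka : hz k ⬝ᵥ hv a ≠ 0) :
    LinearIndependent ℚ (famP (bs ++ [a]) (bs.length + 1)) := by
  rw [linearIndependent_finSucc', init_famP_append, famP_append_last]
  refine ⟨h, notMem_span_of_dot _ (hz k) _ (famP_forall bs rfl (fun w => w ⬝ᵥ hz k = 0) ?_) ?_⟩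
  · intro r hr; rw [dotProduct_comm]; exact hk r hr
  · rw [dotProduct_comm]; exact hka

/-- The entries of `hE t` before the constant. [folklore] -/
theorem hE_apply_lt (t : ℕ) (i : Fin 13) (hi : (i : ℕ) < 12) :
    hE t i = if (i : ℕ) / 4 = t then 1 else 0 := by
  simp only [hE, qent]
  rw [getD_rowOneAff_lt t i hi, getD_rowOne t i hi]
  split_ifs <;> simp

/-- The three normalisation functionals are independent (the root of the tree). [folklore] -/
theorem famG_nil_indep : LinearIndependent ℚ (famG [] 3) := by
  have hfam : famG [] 3 = fun t : Fin 3 => hE t := by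
    funext i; simp only [famG, Glist, List.map_nil, List.append_nil]
    fin_cases i <;> rfl
  rw [hfam, Fintype.linearIndependent_iff]
  intro c hc t
  have h := congrFun hc ⟨4 * t, by omega⟩
  simp only [Finset.sum_apply, Pi.smul_apply, smul_eq_mul, Pi.zero_apply] at h
  rw [Fin.sum_univ_three] at h
  have e : ∀ s : Fin 3, hE s ⟨4 * t, by omega⟩ = if (t : ℕ) = s then 1 else 0 := by
    intro s
    rw [hE_apply_lt s _ (by simp only; omega)]
    simp only [Nat.mul_div_cancel_left _ (by norm_num : 0 < 4)]
  rw [e 0, e 1, e 2] at h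
  fin_cases t <;> simp at h ⊢ <;> exact h

/-- A homogenised listed vertex is non-zero (its last coordinate is the denominator). [folklore] -/
theorem hv_ne_zero (hglob : checkGlobal = true) {r : ℕ} (hr : r < nV) : hv r ≠ 0 := by
  intro h
  have := congrFun h (Fin.last 12)
  simp only [hv, Fin.val_last, Pi.zero_apply] at this
  exact den_ne_zero hglob hr this

/-- Pairing with `(u, 0)` sees only the linear part. [folklore] -/
theorem snoc_zero_dotProduct (u : Fin 12 → ℚ) (w : Fin 13 → ℚ) :
    (Fin.snoc u 0 : Fin 13 → ℚ) ⬝ᵥ w = u ⬝ᵥ linPart w := by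
  simp only [dotProduct, Fin.sum_univ_castSucc, Fin.snoc_castSucc, Fin.snoc_last, zero_mul, add_zero,
    linPart]

/-- Auxiliary lemma `linPart_snoc_zero`. [folklore] -/
theorem linPart_snoc_zero (u : Fin 12 → ℚ) : linPart (Fin.snoc u 0 : Fin 13 → ℚ) = u := by
  funext i; simp only [linPart, Fin.snoc_castSucc]

/-- Downward induction below a bound. [folklore] -/
theorem down_induction {P : ℕ → Prop} {N : ℕ}
    (h : ∀ m, m < N → (∀ c, m < c → c < N → P c) → P m) : ∀ m, m < N → P m := by
  have key : ∀ j m, m < N → N ≤ m + j + 1 → P m := by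
    intro j
    induction j with
    | zero => intro m hm hj; exact h m hm (fun c hc hcN => by omega)
    | succ j ihj => intro m hm hj; exact h m hm (fun c hc hcN => ihj c hcN (by omega))
  intro m hm
  exact key N m hm (by omega)

end Families

/-! ## §6 The inductions over the certificate -/

section Induction

variable (hall : ∀ m, m < numNodes → checkNode m = true) (hglob : checkGlobal = true)
include hall

/-- Every node below `numNodes` has a record satisfying the node facts. [folklore] -/
theorem node_ok {c : ℕ} (hc : c < numNodes) : ∃ rc, node c = some rc ∧ NodeOK c rc := by
  obtain ⟨rc, h1, h2⟩ := exists_rec_of_checkNode (hall c hc)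
  exact ⟨rc, h1, nodeOK_of_check h2⟩

/-- The node facts of a given record. [folklore] -/
theorem nodeOK_of_node {c : ℕ} (hc : c < numNodes) {rc : Rec} (h : node c = some rc) : NodeOK c rc := by
  obtain ⟨rc', h1, h2⟩ := node_ok hall hc
  rw [h] at h1
  obtain rfl : rc = rc' := Option.some.inj h1
  exact h2

omit hall in
/-- Public data agree with the record. [folklore] -/
theorem pub_eq_of_node {c : ℕ} {rc : Rec} {cc : Pub} (h : node c = some rc) (hcc : ifcEntry c = some cc) :
    cc = ⟨rc.apex, rc.B, rc.R, rc.basis⟩ := by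
  have := ifcEntry_of_node c rc h
  rw [hcc] at this
  exact Option.some.inj this

include hglob

/-- **Top-down: the functionals `hE t`, `hz b` (`b ∈ B m`) of every node are linearly
independent** (along the discovery tree `B m = B parent ++ [cut row]`, the cut row not vanishing
at the parent's apex where all the others vanish). [folklore] -/
theorem indepG_all : ∀ m, m < numNodes → ∀ rc, node m = some rc →
    LinearIndependent ℚ (famG rc.B (rc.B.length + 3)) := by
  intro m
  induction m using Nat.strong_induction_on with
  | _ m ih =>
    intro hm rc hrc
    have hok := nodeOK_of_node hall hm hrc
    by_cases hm0 : m = 0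
    · subst hm0
      rw [tree_root_of_check hok.tree]
      exact famG_nil_indep
    · obtain ⟨pp, -, hparlt, -, -, hifc, hB, -, hne⟩ := treeOK_of_check hm0 hok.tree
      obtain ⟨rcp, hrcp, hokp⟩ := node_ok hall (lt_trans hparlt hm)
      have hpp := pub_eq_of_node hrcp hifc
      subst hpp
      have ihp := ih (rc.par - 1) hparlt (lt_trans hparlt hm) rcp hrcp
      rw [hB, List.length_append, List.length_singleton]
      exact famG_append_indep rcp.B (rc.kcut - 1) ihp (hv rcp.apex)
        (fun t ht => hE_hv hglob hokp.apex_lt ht)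
        (fun b hb => hz_hv_eq_zero (hokp.apex_B b hb)) (hz_hv_ne_zero hne)

/-- **Bottom-up: the homogenised basis vertices of every node are linearly independent**
(`basis m = basis child ++ [apex]`, the cut row vanishing on the child's basis but not at the
apex). [folklore] -/
theorem indepP_all : ∀ m, m < numNodes → ∀ rc, node m = some rc →
    LinearIndependent ℚ (famP rc.basis rc.basis.length) := by
  refine down_induction (N := numNodes) ?_
  intro m hm ih rc hrc
  have hok := nodeOK_of_node hall hm hrc
  rcases basisOK_of_check hok.cbasis with hleaf | ⟨kd, hkd, cc, hifc, hbasis, hne⟩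
  · rw [hleaf, List.length_singleton, linearIndependent_unique_iff]
    have : famP [rc.apex] 1 default = hv rc.apex := by simp [famP]
    rw [this]
    exact hv_ne_zero hglob hok.apex_lt
  · obtain ⟨cc', hkid⟩ := kidOK_of_check (hok.kids kd hkd)
    have hcc : cc' = cc := by
      have := hkid.ifc; rw [hifc] at this; exact (Option.some.inj this).symm
    subst hcc
    obtain ⟨rcc, hrcc, -⟩ := node_ok hall hkid.c_lt
    have hpub := pub_eq_of_node hrcc hkid.ifc
    have ihc := ih kd.c hkid.lt hkid.c_lt rcc hrcc
    have hcb : cc'.basis = rcc.basis := by rw [hpub]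
    rw [hbasis, List.length_append, List.length_singleton, hcb]
    exact famP_append_indep rcc.basis rc.apex kd.k ihc
      (fun r hr => hz_hv_eq_zero (hkid.basis_k r (hcb ▸ hr))) (hz_hv_ne_zero hne)

/-- **The face recursion**: every point of the face `Q m = {E = 0, g_b = 0 (b ∈ B m),
gₖ ≥ 0 (k ∈ R m)}` of every node is a convex combination of the listed vertices.
[cite: Ziegler1995, Lecture 1 (Thm. 1.1) and §8.1] -/
theorem claim_all : ∀ m, m < numNodes → ∀ rc, node m = some rc → ∀ x, InQ rc x →
    x ∈ convexHull ℚ Vset := by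
  refine down_induction (N := numNodes) ?_
  intro m hm ih rc hrc x hx
  have hok := nodeOK_of_node hall hm hrc
  obtain ⟨hxE, hxB, hxR⟩ := hx
  -- the apex vertex of the face
  have hapex := hok.apex_lt
  set v := vq rc.apex with hv_def
  have hvV : v ∈ Vset := vq_mem_Vset hapex
  have hvE : ∀ t, t < 3 → hE t ⬝ᵥ hx v = 0 := fun t ht => hE_hx_vq hglob hapex ht
  have hvB : ∀ b ∈ rc.B, gq b v = 0 := fun b hb => (gq_vq_eq_zero_iff hglob hapex b).2 (hok.apex_B b hb)
  have hvR : ∀ k ∈ rc.R, 0 ≤ gq k v := fun k hk => (gq_vq_nonneg_iff hglob hapex k).2 (hok.apex_R k hk)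
  by_cases hex : ∃ k ∈ rc.R, aq k ⬝ᵥ (x - v) < 0
  · /- Case A: line shooting from the apex through `x` leaves the face through a child face. -/
    obtain ⟨t, k₀, hk₀, ht, hyR, hy0, hneg⟩ := HullCert.exists_exit_point rc.R.toFinset aq
      (fun k => qent (rowAz k) 12) v x
      (fun k hk => by rw [← gq_eq]; exact hvR k (List.mem_toFinset.1 hk))
      (fun k hk => by rw [← gq_eq]; exact hxR k (List.mem_toFinset.1 hk))
      (by obtain ⟨k, hk, hlt⟩ := hex; exact ⟨k, List.mem_toFinset.2 hk, hlt⟩)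
    rw [List.mem_toFinset] at hk₀
    set y := v + t • (x - v) with hy_def
    have hyR' : ∀ k ∈ rc.R, 0 ≤ gq k y := fun k hk => by
      rw [gq_eq]; exact hyR k (List.mem_toFinset.2 hk)
    have hy0' : gq k₀ y = 0 := by rw [gq_eq]; exact hy0
    have hyE : ∀ s, s < 3 → hE s ⬝ᵥ hx y = 0 := fun s hs => by
      rw [hy_def, hE_line, hvE s hs, hxE s hs]; ring
    have hyB : ∀ b ∈ rc.B, gq b y = 0 := fun b hb => by
      rw [hy_def, gq_line, hvB b hb, hxB b hb]; ring
    -- the exit row is positive at the apex, so it is cut by a child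
    have hpos : 0 < gq k₀ v := by
      have e : gq k₀ y = gq k₀ v + t * (gq k₀ x - gq k₀ v) := gq_line k₀ v x t
      rw [hy0', gq_sub] at e
      have : 0 < t * -(aq k₀ ⬝ᵥ (x - v)) := mul_pos (by linarith) (by linarith)
      linarith
    have hne : dotL (rowAz k₀) (rowVert rc.apex) ≠ 0 := fun h0 =>
      hpos.ne' ((gq_vq_eq_zero_iff hglob hapex k₀).2 h0)
    obtain ⟨kd, hkd, hkdk⟩ := (hok.cover k₀ hk₀).resolve_left hne
    obtain ⟨cc, hkid⟩ := kidOK_of_check (hok.kids kd hkd)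
    obtain ⟨rcc, hrcc, hokc⟩ := node_ok hall hkid.c_lt
    have hpub := pub_eq_of_node hrcc hkid.ifc
    have hcb : cc.basis = rcc.basis := by rw [hpub]
    have hcR : cc.R = rcc.R := by rw [hpub]
    -- the exit point lies on the child's face
    have hyQ : InQ rcc y := by
      refine ⟨hyE, ?_, ?_⟩
      · -- the child's equality rows vanish at `y`: transfer along the edge of the face lattice
        intro b' hb'
        have hind : LinearIndependent ℚ (famG (rc.B ++ [k₀]) (rc.B.length + 1 + 3)) :=
          famG_append_indep rc.B k₀ (indepG_all hall hglob m hm rc hrc) (hv rc.apex)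
            (fun s hs => hE_hv hglob hapex hs) (fun b hb => hz_hv_eq_zero (hok.apex_B b hb))
            (hz_hv_ne_zero hne)
        have hindP := indepP_all hall hglob kd.c hkid.c_lt rcc hrcc
        show hz b' ⬝ᵥ hx y = 0
        refine HullCert.dot_eq_zero_of_forall_dot_eq_zero (famG (rc.B ++ [k₀]) (rc.B.length + 1 + 3))
          (famP rcc.basis rcc.basis.length) hind hindP ?_ ?_ ?_ ?_
        · refine famG_forall (rc.B ++ [k₀]) (by simp)
            (fun g => ∀ j, g ⬝ᵥ famP rcc.basis rcc.basis.length j = 0) ?_ ?_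
          · intro s hs
            exact famP_forall rcc.basis rfl (fun w => hE s ⬝ᵥ w = 0)
              (fun r hr => hE_hv hglob (hokc.basis_lt r hr) hs)
          · intro b hb
            refine famP_forall rcc.basis rfl (fun w => hz b ⬝ᵥ w = 0) (fun r hr => ?_)
            rw [List.mem_append, List.mem_singleton] at hb
            rcases hb with hb | hb
            · exact hz_hv_eq_zero (hkid.basis_B r (hcb ▸ hr) b hb)
            · rw [hb, ← hkdk]; exact hz_hv_eq_zero (hkid.basis_k r (hcb ▸ hr))
        · have := hkid.count; rw [hcb] at this; omega
        · exact famP_forall rcc.basis rfl (fun w => hz b' ⬝ᵥ w = 0)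
            (fun r hr => hz_hv_eq_zero (hokc.basis_B r hr b' hb'))
        · refine famG_forall (rc.B ++ [k₀]) (by simp) (fun g => g ⬝ᵥ hx y = 0) hyE ?_
          intro b hb
          rw [List.mem_append, List.mem_singleton] at hb
          rcases hb with hb | hb
          · exact hyB b hb
          · rw [hb]; exact hy0'
      · -- the child's inequality rows hold at `y`: rows of `m`, or Farkas certificates
        intro k' hk'
        rcases hkid.cover k' (hcR ▸ hk') with h1 | h1 | h1 | ⟨ce, -, hrow, hcert⟩
        · exact hyR' k' h1
        · exact (hyB k' h1).ge
        · rw [h1, hkdk]; exact hy0'.ge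
        · obtain ⟨hD, hid⟩ := cert_identity rc (rc.B ++ [kd.k]) ce hcert y
          rw [hrow] at hid
          have h1 : 0 ≤ ((List.zip ce.y rc.R).map fun p => ((p.1 : ℕ) : ℚ) * gq p.2 y).sum :=
            List.sum_nonneg (by
              intro q hq; rw [List.mem_map] at hq; obtain ⟨p, hp, rfl⟩ := hq
              exact mul_nonneg (Nat.cast_nonneg _) (hyR' _ (List.of_mem_zip hp).2))
          have h2 : ((List.zip ce.w (rc.B ++ [kd.k])).map fun p => (p.1 : ℚ) * gq p.2 y).sum = 0 :=
            List.sum_eq_zero (by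
              intro q hq; rw [List.mem_map] at hq; obtain ⟨p, hp, rfl⟩ := hq
              have hm := (List.of_mem_zip hp).2
              rw [List.mem_append, List.mem_singleton] at hm
              rcases hm with hm | hm
              · rw [hyB _ hm, mul_zero]
              · rw [hm, hkdk, hy0', mul_zero])
          have h3 : ((List.zip ce.wp [0, 1, 2]).map fun p => (p.1 : ℚ) * (hE p.2 ⬝ᵥ hx y)).sum = 0 :=
            List.sum_eq_zero (by
              intro q hq; rw [List.mem_map] at hq; obtain ⟨p, hp, rfl⟩ := hq
              have hm := (List.of_mem_zip hp).2
              have hp3 : p.2 < 3 := by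
                simp only [List.mem_cons, List.mem_nil_iff, or_false] at hm; omega
              rw [hyE _ hp3, mul_zero])
          rw [h2, h3] at hid
          have hs : (0 : ℚ) ≤ ce.s := Nat.cast_nonneg _
          have hDq : (0 : ℚ) < ce.D := by exact_mod_cast hD
          by_contra hlt
          push Not at hlt
          have := mul_neg_of_pos_of_neg hDq hlt
          linarith
    exact HullCert.mem_convexHull_of_exit ht hvV (ih kd.c hkid.lt hkid.c_lt rcc hrcc y hyQ)
  · /- Case B: no inequality decreases from the apex towards `x`; boundedness forces `x = apex`. -/
    push Not at hex
    set u := x - v with hu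
    obtain ⟨hy1, hyl, hident⟩ := bound_identity rc hok.bound
    have hBu : ∀ b ∈ rc.B, aq b ⬝ᵥ u = 0 := fun b hb => by
      rw [hu, ← gq_sub, hxB b hb, hvB b hb, sub_zero]
    have hEu : ∀ s, s < 3 → linPart (hE s) ⬝ᵥ u = 0 := fun s hs => by
      rw [hu, ← dot_hx_sub, hxE s hs, hvE s hs, sub_zero]
    have hdot := congrArg (fun w => w ⬝ᵥ u) hident
    simp only [add_dotProduct, list_sum_dotProduct, List.map_map, zero_dotProduct] at hdot
    have h2 : ((List.zip rc.z rc.B).map ((fun w => w ⬝ᵥ u) ∘ fun p => (p.1 : ℚ) • aq p.2)).sum = 0 :=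
      List.sum_eq_zero (by
        intro q hq; rw [List.mem_map] at hq; obtain ⟨p, hp, rfl⟩ := hq
        simp only [Function.comp, smul_dotProduct, hBu _ (List.of_mem_zip hp).2, smul_zero])
    have h3 : ((List.zip rc.zp [0, 1, 2]).map
        ((fun w => w ⬝ᵥ u) ∘ fun p => (p.1 : ℚ) • linPart (hE p.2))).sum = 0 :=
      List.sum_eq_zero (by
        intro q hq; rw [List.mem_map] at hq; obtain ⟨p, hp, rfl⟩ := hq
        have hm := (List.of_mem_zip hp).2
        have hp3 : p.2 < 3 := by
          simp only [List.mem_cons, List.mem_nil_iff, or_false] at hm; omega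
        simp only [Function.comp, smul_dotProduct, hEu _ hp3, smul_zero])
    rw [h2, h3, add_zero, add_zero] at hdot
    -- every inequality normal of the face is orthogonal to `u`
    have hRu : ∀ k ∈ rc.R, aq k ⬝ᵥ u = 0 := by
      have hl := forall_zero_of_list_sum
        ((List.zip rc.y rc.R).map fun p => (((p.1 : ℤ) : ℚ), aq p.2 ⬝ᵥ u))
        (by
          intro q hq; rw [List.mem_map] at hq; obtain ⟨p, hp, rfl⟩ := hq
          have := hy1 _ (List.of_mem_zip hp).1
          show (1 : ℚ) ≤ ((p.1 : ℤ) : ℚ)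
          exact_mod_cast this)
        (by
          intro q hq; rw [List.mem_map] at hq; obtain ⟨p, hp, rfl⟩ := hq
          exact hex _ (List.of_mem_zip hp).2)
        (by
          rw [List.map_map, ← hdot]
          refine congrArg List.sum (List.map_congr_left fun p _ => ?_)
          simp only [Function.comp, smul_dotProduct, smul_eq_mul])
      intro k hk
      obtain ⟨y0, -, hmem⟩ := exists_mem_zip_left rc.y rc.R hyl hk
      exact hl _ (List.mem_map.2 ⟨(y0, k), hmem, rfl⟩)
    -- `(u, 0)` lies in the span of the homogenised basis vertices (dimension count)
    set d := 9 - rc.B.length with hd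
    have hbl : rc.basis.length = d + 1 := hok.basis_len
    have hindP := indepP_all hall hglob m hm rc hrc
    rw [hbl] at hindP
    have hindG := indepG_all hall hglob m hm rc hrc
    have hmem : (Fin.snoc u 0 : Fin 13 → ℚ) ∈ Submodule.span ℚ (Set.range (famP rc.basis (d + 1))) := by
      refine HullCert.mem_span_of_forall_dot_eq_zero (famP rc.basis (d + 1))
        (famG rc.B (rc.B.length + 3)) hindP hindG ?_ ?_ ?_
      · intro i j
        rw [dotProduct_comm]
        revert i
        revert j
        refine famG_forall rc.B rfl (fun g => ∀ i, g ⬝ᵥ famP rc.basis (d + 1) i = 0) ?_ ?_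
        · intro s hs
          exact famP_forall rc.basis hbl.symm (fun w => hE s ⬝ᵥ w = 0)
            (fun r hr => hE_hv hglob (hok.basis_lt r hr) hs)
        · intro b hb
          exact famP_forall rc.basis hbl.symm (fun w => hz b ⬝ᵥ w = 0)
            (fun r hr => hz_hv_eq_zero (hok.basis_B r hr b hb))
      · have := hok.B_len; omega
      · refine famG_forall rc.B rfl (fun g => (Fin.snoc u 0 : Fin 13 → ℚ) ⬝ᵥ g = 0) ?_ ?_
        · intro s hs; rw [snoc_zero_dotProduct, dotProduct_comm]; exact hEu s hs
        · intro b hb; rw [snoc_zero_dotProduct, dotProduct_comm, linPart_hz]; exact hBu b hb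
    obtain ⟨c, hc⟩ := (Submodule.mem_span_range_iff_exists_fun ℚ).1 hmem
    have hc' : (∑ j : Fin (d + 1), c j • hv (rc.basis.getD j 0)) = Fin.snoc u 0 := hc
    have hc0 : c = 0 := by
      refine dir_coeff_eq_zero rc d hbl hok.d_le hok.dir c ?_ ?_
      · intro i hi
        rw [hc', linPart_snoc_zero]
        exact hRu _ (getD_mem_of_lt _ _ (lt_of_lt_of_le hi hok.d_le))
      · rw [hc']; exact Fin.snoc_last _ _
    have hu0 : u = 0 := by
      rw [← linPart_snoc_zero u, ← hc', hc0]
      funext i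
      simp [linPart]
    have hxv : x = v := sub_eq_zero.1 hu0
    rw [hxv]
    exact subset_convexHull ℚ Vset hvV

end Induction

/-! ## §7 The verified V-description -/

/-- Positivity of the number of nodes. [folklore] -/
theorem numNodes_pos : 0 < numNodes := by simp [numNodes]

/-- **`{E = 0, 270 facets ≥ 0} ⊆ conv(328 vertices)` from the checks.** If every node of the
certificate passes `checkNode` and the global checks pass, then every `x ∈ ℚ¹²` whose three blocks
each sum to `1` and which satisfies the `270` Vergne–Walter inequalities `gₖ(x) ≥ 0` is a (rational)
convex combination of the `328` listed vertices of `Kron(4,4,4)`.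
[cite: Ziegler1995, Lecture 1, Thm. 1.1] [cite: VergneWalter2014, §6.2 and Tables] -/
theorem mem_convexHull_of_checks (hall : ∀ m, m < numNodes → checkNode m = true)
    (hglob : checkGlobal = true) (x : Fin 12 → ℚ)
    (hxE : ∀ t, t < 3 → hE t ⬝ᵥ hx x = 0) (hxF : ∀ k, k < nF → 0 ≤ gq k x) :
    x ∈ convexHull ℚ Vset := by
  obtain ⟨-, rc0, h0, hB0, -, -⟩ := globalOK_of_check hglob
  have hok0 := nodeOK_of_node hall numNodes_pos h0
  refine claim_all hall hglob 0 numNodes_pos rc0 h0 x ⟨hxE, ?_, ?_⟩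
  · intro b hb; rw [hB0] at hb; exact absurd hb List.not_mem_nil
  · intro k hk; exact hxF k (hok0.R_lt k hk)

end Kron444Hull

end Literature.Computability.AlgebraicComplexity
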